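import Summits.QuantumFields.YangMills.Theorems.FluctuationComparisonRegPrIntLOrganTangentFibreMeanVersionMW
import Summits.QuantumFields.YangMills.Theorems.FluctuationComparisonRegPrIntLOrganTangentAPackageDescendTo
import Summits.QuantumFields.YangMills.Theorems.FluctuationComparisonRegPrIntLOrganTangentFibreMeanSquareResponse
import Summits.QuantumFields.YangMills.Theorems.FluctuationComparisonRegPrIntLOrganTangentFibreMeanVersionUnique
import Summits.QuantumFields.YangMills.Theorems.FluctuationComparisonRegPrIntLOrganTangentGaugeConjugateProbe
import Summits.QuantumFields.YangMills.Theorems.FluctuationComparisonRegPrIntLOrganTangentSigmaVersionChartMean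
import Summits.QuantumFields.YangMills.Theorems.FluctuationComparisonRegPrIntLOrganTangentMultiWindowWeight
import Literature.MathematicalPhysics.QuantumFieldTheory.Balaban1983to89.BalabanAdmissibleClassParams
import Literature.MathematicalPhysics.QuantumFieldTheory.Balaban1983to89.T4AveragingDisintegration
import Literature.MathematicalPhysics.QuantumFieldTheory.Balaban1983to89.T4CubeChartExp
import HarnessLib

/-!
# Crux `FluctuationComparisonRegPrIntL` (stmt-QuantumFields-20520, rung R3), PATH-B organ — THE LIN KNIT, SORRY-FREE (LEAD workfile v1.1):
# `SpreadFibreLawH` (ideator g28, (B′) v0.3k 167cd358, INT-CONCL) ⟹ LINᵘ-H″ (LIN′ edc3b855 with the `∃ pW … pW ≤ p₀ →` head; provisional until v18.2 cuts LIN″)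

Cell `ym3-torus` (YM ladder rung R3 = continuum `SU(2)` Yang–Mills on the three-torus — a RUNG: NOT d = 4, NOT infinite volume, NOT a mass gap, NOT Clay).
LEAD-20520 width seat `ym-ust-20520-w3` (gen 25).  A Cruxes WORKFILE, v1.1 SORRY-FREE: helpers ✓p811942 `…SigmaChartJunction` and ✓p812016 `…SigmaVersionChartMean` IMPORTED from the tree; g28's HOME
SIGNATURE `FibreLawH` v0.3k 167cd358 (INT-CONCL) still INLINED VERBATIM below until his tree write lands (then: `import …Cruxes…FibreLawH`, delete the copy).  Steps (LEAD №27 (f), g28 LIN-KNIT-FROM-v0.3i):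
(0) heads ∕ package; (1) per stride: chart + (H); (2) σ-version = chart fibre mean on the window (✓L21a–e, ✓VU); (3) ✓R2b per square; (4) witnesses.

HONEST FRAMING: bookkeeping over HYPOTHESIS schemas; nothing of Bałaban's analysis is asserted or proved; `SpreadFibreLawH`, LIN″, JEN″, O1ᵘ-H v2.x, S1aᴴ, S3ᴴ,
S2α′, S2β, 26243 OPEN; crux 20520 `FluctuationComparisonRegPrIntL` ∕ `YM3TorusSU2` NOT proved; registry untouched; rung R3 = SU(2) YM₃ on T³ at fixed lattice data —
NOT d = 4, NOT infinite volume, NOT a mass gap, NOT Clay; the Yang–Mills mass gap is NOT proved.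
-/

set_option autoImplicit false

noncomputable section

namespace Summit.QuantumFields.YangMills.Cruxes.FluctuationComparisonRegPrIntL.FibreLawH

open MeasureTheory Filter Topology Function
open scoped ENNReal NNReal BigOperators
open Literature.MathematicalPhysics.QuantumFieldTheory.Balaban1983to89 T3ContinuumYM3Torus T3NestedUnitLaws
  T3UnitLawDensityEML T4Continuum BalabanUVClass T3UnitScaleTilt T3LevelShift T3TiltDescent
open T4CubeChartExp (expPt)

/-! ## §1 The weights `ŵ_t` -/

/-- `χ_{j,Ts}(U)` — the multi-window soft cut of the stride `(j, Ts)` read on the fine field (LINᵘ-H / LEAD draft spelling, product of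
`sfCut (θBal (j+1+i)) ∘ descendTo (j+1+i) Ts` over `i < Ts − j`; R-CUT-χ token `max 0 (min 1 ((24∕25·θ − dist1)∕((24∕25 − 1∕2)·θ)))`). -/
def mwCut (F : T3Family) (γ b₀ p₀ : ℝ) (j Ts : ℕ) (U : GaugeField (F.P Ts) 0 ↥(Matrix.specialUnitaryGroup (Fin 2) ℂ)) : ℝ :=
  ∏ i ∈ Finset.range (Ts - j), (if h : j + 1 + i ≤ Ts then (∏ p : Plaq (F.P (j + 1 + i)) 0, max 0 (min 1 ((24 / 25 * θBal F.L γ b₀ p₀ (j + 1 + i)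
    - dist1 (GaugeField.plaqHol (descendTo F ℰp (j + 1 + i) Ts h U) p)) / ((24 / 25 - 1 / 2) * θBal F.L γ b₀ p₀ (j + 1 + i))))) else 1)

/-- Numerator of the interpolated fibre weight: `χ_{j,Ts}(Φ(V,z))·ρ_{Ts}(Φ(V,z))^t·ρ′_{Ts}(Φ(V,z))^{1−t}·J(V,z)` (`t = 0`: LIN's `χ·ρ′·J`). -/
def wNum (F : T3Family) (γ b₀ p₀ : ℝ) (j Ts : ℕ)
    (ρ ρ' : (i : ℕ) → GaugeField (F.P i) 0 ↥(Matrix.specialUnitaryGroup (Fin 2) ℂ) → ℝ) {Z : Type}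
    (Φ : GaugeField (F.P j) 0 ↥(Matrix.specialUnitaryGroup (Fin 2) ℂ) × Z → GaugeField (F.P Ts) 0 ↥(Matrix.specialUnitaryGroup (Fin 2) ℂ))
    (J : GaugeField (F.P j) 0 ↥(Matrix.specialUnitaryGroup (Fin 2) ℂ) × Z → NNReal) (t : ℝ)
    (V : GaugeField (F.P j) 0 ↥(Matrix.specialUnitaryGroup (Fin 2) ℂ)) (z : Z) : ℝ :=
  mwCut F γ b₀ p₀ j Ts (Φ (V, z)) * (Real.rpow (ρ Ts (Φ (V, z))) t * Real.rpow (ρ' Ts (Φ (V, z))) (1 - t)) * (J (V, z) : ℝ)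

/-- The normalised interpolated fibre weight `ŵ_t(V, z) := wNum ∕ ∫ wNum dτ` (the fibre LAW over `V` as a density w.r.t. `τ`). -/
def wgt (F : T3Family) (γ b₀ p₀ : ℝ) (j Ts : ℕ)
    (ρ ρ' : (i : ℕ) → GaugeField (F.P i) 0 ↥(Matrix.specialUnitaryGroup (Fin 2) ℂ) → ℝ) {Z : Type} [MeasurableSpace Z] (τ : Measure Z)
    (Φ : GaugeField (F.P j) 0 ↥(Matrix.specialUnitaryGroup (Fin 2) ℂ) × Z → GaugeField (F.P Ts) 0 ↥(Matrix.specialUnitaryGroup (Fin 2) ℂ))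
    (J : GaugeField (F.P j) 0 ↥(Matrix.specialUnitaryGroup (Fin 2) ℂ) × Z → NNReal) (t : ℝ)
    (V : GaugeField (F.P j) 0 ↥(Matrix.specialUnitaryGroup (Fin 2) ℂ)) (z : Z) : ℝ :=
  wNum F γ b₀ p₀ j Ts ρ ρ' Φ J t V z / (∫ z', wNum F γ b₀ p₀ j Ts ρ ρ' Φ J t V z' ∂τ)

/-! ## §2 Rows and clauses (abstract in the coarse / fine lattices `P`, `Q`, a chart `Φ` over a fibre space `Z`, a weight family `W V z`) -/

/-- `L²(law)`-ROW of an ambient test function `g : G_Q → ℝ` read through `Ψ : Z → G_Q` under the weight `w`: for every fine bond `a` and every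
one-bond move `u` of size `≤ rf·θf`, `∫ (g(Ψ z·e^{u}@a) − g(Ψ z))²·w z dτ ≤ (ℓ a·‖u‖∕θf)²`. -/
def L2Row {Q : Params} {Z : Type} [MeasurableSpace Z] (τ : Measure Z)
    (Ψ : Z → GaugeField Q 0 ↥(Matrix.specialUnitaryGroup (Fin 2) ℂ)) (w : Z → ℝ) (θf rf : ℝ)
    (g : GaugeField Q 0 ↥(Matrix.specialUnitaryGroup (Fin 2) ℂ) → ℝ) (ℓ : PBond Q 0 → ℝ) : Prop :=
  ∀ (a : PBond Q 0) (u : Fin 3 → ℝ), ‖u‖ ≤ rf * θf →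
    ∫ z, (g (Function.update (Ψ z) a ((Ψ z) a * expPt u)) - g (Ψ z)) ^ 2 * w z ∂τ ≤ (ℓ a * (‖u‖ / θf)) ^ 2

/-- (S) TAIL: under every window law the `ŵ`-mass of the complement of the `θd`-deep fine window is `≤ ES`. -/
def TailClause {P Q : Params} {Z : Type} [MeasurableSpace Z] (τ : Measure Z)
    (Φ : GaugeField P 0 ↥(Matrix.specialUnitaryGroup (Fin 2) ℂ) × Z → GaugeField Q 0 ↥(Matrix.specialUnitaryGroup (Fin 2) ℂ))
    (W : GaugeField P 0 ↥(Matrix.specialUnitaryGroup (Fin 2) ℂ) → Z → ℝ) (θc θd ES : ℝ) : Prop :=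
  ∀ V : GaugeField P 0 ↥(Matrix.specialUnitaryGroup (Fin 2) ℂ), PlaqSmall θc V → ∫ z in {z | ¬ PlaqSmall θd (Φ (V, z))}, W V z ∂τ ≤ ES

/-- (L0) COVARIANCE, Helffer–Sjöstrand / Brascamp–Lieb SHAPE: `|E_W(f̂ĝ) − E_W f̂·E_W ĝ| ≤ Σ_{a,c} ℓf a·D a c·ℓg c` for test functions through the base chart
with `L²(W V)`-rows `ℓf, ℓg`. -/
def CovClause {P Q : Params} {Z : Type} [MeasurableSpace Z] (τ : Measure Z)
    (Φ : GaugeField P 0 ↥(Matrix.specialUnitaryGroup (Fin 2) ℂ) × Z → GaugeField Q 0 ↥(Matrix.specialUnitaryGroup (Fin 2) ℂ))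
    (W : GaugeField P 0 ↥(Matrix.specialUnitaryGroup (Fin 2) ℂ) → Z → ℝ) (θc θf rf : ℝ) (D : PBond Q 0 → PBond Q 0 → ℝ) : Prop :=
  ∀ (V : GaugeField P 0 ↥(Matrix.specialUnitaryGroup (Fin 2) ℂ)), PlaqSmall θc V →
  ∀ (f g : GaugeField Q 0 ↥(Matrix.specialUnitaryGroup (Fin 2) ℂ) → ℝ) (ℓf ℓg : PBond Q 0 → ℝ),
    Integrable (fun z => f (Φ (V, z)) * W V z) τ → Integrable (fun z => g (Φ (V, z)) * W V z) τ →
    Integrable (fun z => f (Φ (V, z)) * g (Φ (V, z)) * W V z) τ →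
    L2Row τ (fun z => Φ (V, z)) (W V) θf rf f ℓf → L2Row τ (fun z => Φ (V, z)) (W V) θf rf g ℓg →
    |(∫ z, f (Φ (V, z)) * g (Φ (V, z)) * W V z ∂τ) - (∫ z, f (Φ (V, z)) * W V z ∂τ) * (∫ z, g (Φ (V, z)) * W V z ∂τ)|
      ≤ ∑ a, ∑ c, ℓf a * D a c * ℓg c

/-- (L1) FIRST-ORDER LAW RESPONSE on a window edge `V → V′ = V·e^{m′}@B′`: `|E_{W V′} ĝ − E_{W V} ĝ| ≤ (Σ_c ℓ c·R₁ c B′)·‖m′‖∕θc`, test function through the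
BASE chart, rows under both laws. -/
def Resp1Clause {P Q : Params} {Z : Type} [MeasurableSpace Z] (τ : Measure Z)
    (Φ : GaugeField P 0 ↥(Matrix.specialUnitaryGroup (Fin 2) ℂ) × Z → GaugeField Q 0 ↥(Matrix.specialUnitaryGroup (Fin 2) ℂ))
    (W : GaugeField P 0 ↥(Matrix.specialUnitaryGroup (Fin 2) ℂ) → Z → ℝ) (θc rc θf rf : ℝ) (R₁ : PBond Q 0 → PBond P 0 → ℝ) : Prop :=
  ∀ (B' : PBond P 0) (m' : Fin 3 → ℝ) (V V' : GaugeField P 0 ↥(Matrix.specialUnitaryGroup (Fin 2) ℂ)),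
    ‖m'‖ ≤ rc * θc → PlaqSmall θc V → PlaqSmall θc V' → (∀ e, e ≠ B' → V' e = V e) → V' B' = V B' * expPt m' →
  ∀ (g : GaugeField Q 0 ↥(Matrix.specialUnitaryGroup (Fin 2) ℂ) → ℝ) (ℓ : PBond Q 0 → ℝ),
    Integrable (fun z => g (Φ (V, z)) * W V z) τ → Integrable (fun z => g (Φ (V, z)) * W V' z) τ →
    L2Row τ (fun z => Φ (V, z)) (W V) θf rf g ℓ → L2Row τ (fun z => Φ (V, z)) (W V') θf rf g ℓ →
    |(∫ z, g (Φ (V, z)) * W V' z ∂τ) - (∫ z, g (Φ (V, z)) * W V z ∂τ)| ≤ (∑ c, ℓ c * R₁ c B') * (‖m'‖ / θc)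

/-- (L2) SECOND-ORDER LAW RESPONSE on a window square (corners `V00 V10 V01 V11`, `HClauseSq` binder shape):
`|E_{W V11} ĝ − E_{W V10} ĝ − E_{W V01} ĝ + E_{W V00} ĝ| ≤ (Σ_c ℓ c·R₂ c B B′)·(‖m‖∕θc)·(‖m′‖∕θc)`, test function through the BASE chart `V00`, rows under the four laws. -/
def Resp2Clause {P Q : Params} {Z : Type} [MeasurableSpace Z] (τ : Measure Z)
    (Φ : GaugeField P 0 ↥(Matrix.specialUnitaryGroup (Fin 2) ℂ) × Z → GaugeField Q 0 ↥(Matrix.specialUnitaryGroup (Fin 2) ℂ))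
    (W : GaugeField P 0 ↥(Matrix.specialUnitaryGroup (Fin 2) ℂ) → Z → ℝ) (θc rc θf rf : ℝ) (R₂ : PBond Q 0 → PBond P 0 → PBond P 0 → ℝ) : Prop :=
  ∀ (B B' : PBond P 0) (m m' : Fin 3 → ℝ) (V00 V10 V01 V11 : GaugeField P 0 ↥(Matrix.specialUnitaryGroup (Fin 2) ℂ)),
    ‖m‖ ≤ rc * θc → ‖m'‖ ≤ rc * θc → PlaqSmall θc V00 → PlaqSmall θc V10 → PlaqSmall θc V01 → PlaqSmall θc V11 →
    (∀ e, e ≠ B → V10 e = V00 e) → V10 B = V00 B * expPt m → (∀ e, e ≠ B' → V01 e = V00 e) → V01 B' = V00 B' * expPt m' →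
    (∀ e, e ≠ B' → V11 e = V10 e) → V11 B' = V10 B' * expPt m' →
  ∀ (g : GaugeField Q 0 ↥(Matrix.specialUnitaryGroup (Fin 2) ℂ) → ℝ) (ℓ : PBond Q 0 → ℝ),
    Integrable (fun z => g (Φ (V00, z)) * W V00 z) τ → Integrable (fun z => g (Φ (V00, z)) * W V10 z) τ →
    Integrable (fun z => g (Φ (V00, z)) * W V01 z) τ → Integrable (fun z => g (Φ (V00, z)) * W V11 z) τ →
    L2Row τ (fun z => Φ (V00, z)) (W V00) θf rf g ℓ → L2Row τ (fun z => Φ (V00, z)) (W V10) θf rf g ℓ →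
    L2Row τ (fun z => Φ (V00, z)) (W V01) θf rf g ℓ → L2Row τ (fun z => Φ (V00, z)) (W V11) θf rf g ℓ →
    |(∫ z, g (Φ (V00, z)) * W V11 z ∂τ) - (∫ z, g (Φ (V00, z)) * W V10 z ∂τ) - (∫ z, g (Φ (V00, z)) * W V01 z ∂τ)
        + (∫ z, g (Φ (V00, z)) * W V00 z ∂τ)| ≤ (∑ c, ℓ c * R₂ c B B') * (‖m‖ / θc) * (‖m'‖ / θc)

/-- (L21) FIRST-ORDER RESPONSE OF THE SECOND CUMULANT on a window edge: for two test functions through the base chart, centred at their BASE means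
`cf = E_{W V} f̂`, `cg = E_{W V} ĝ`: `|E_{W V′}((f̂ − cf)(ĝ − cg)) − E_{W V}((f̂ − cf)(ĝ − cg))| ≤ (Σ_{a,c} ℓf a·ℓg c·R₂₁ a c B′)·‖m′‖∕θc`. -/
def Cum2Resp1Clause {P Q : Params} {Z : Type} [MeasurableSpace Z] (τ : Measure Z)
    (Φ : GaugeField P 0 ↥(Matrix.specialUnitaryGroup (Fin 2) ℂ) × Z → GaugeField Q 0 ↥(Matrix.specialUnitaryGroup (Fin 2) ℂ))
    (W : GaugeField P 0 ↥(Matrix.specialUnitaryGroup (Fin 2) ℂ) → Z → ℝ) (θc rc θf rf : ℝ) (R₂₁ : PBond Q 0 → PBond Q 0 → PBond P 0 → ℝ) : Prop :=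
  ∀ (B' : PBond P 0) (m' : Fin 3 → ℝ) (V V' : GaugeField P 0 ↥(Matrix.specialUnitaryGroup (Fin 2) ℂ)),
    ‖m'‖ ≤ rc * θc → PlaqSmall θc V → PlaqSmall θc V' → (∀ e, e ≠ B' → V' e = V e) → V' B' = V B' * expPt m' →
  ∀ (f g : GaugeField Q 0 ↥(Matrix.specialUnitaryGroup (Fin 2) ℂ) → ℝ) (ℓf ℓg : PBond Q 0 → ℝ) (cf cg : ℝ),
    Integrable (fun z => f (Φ (V, z)) * W V z) τ → Integrable (fun z => g (Φ (V, z)) * W V z) τ →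
    cf = ∫ z, f (Φ (V, z)) * W V z ∂τ → cg = ∫ z, g (Φ (V, z)) * W V z ∂τ →
    Integrable (fun z => (f (Φ (V, z)) - cf) * (g (Φ (V, z)) - cg) * W V z) τ →
    Integrable (fun z => (f (Φ (V, z)) - cf) * (g (Φ (V, z)) - cg) * W V' z) τ →
    L2Row τ (fun z => Φ (V, z)) (W V) θf rf f ℓf → L2Row τ (fun z => Φ (V, z)) (W V') θf rf f ℓf →
    L2Row τ (fun z => Φ (V, z)) (W V) θf rf g ℓg → L2Row τ (fun z => Φ (V, z)) (W V') θf rf g ℓg →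
    |(∫ z, (f (Φ (V, z)) - cf) * (g (Φ (V, z)) - cg) * W V' z ∂τ) - (∫ z, (f (Φ (V, z)) - cf) * (g (Φ (V, z)) - cg) * W V z ∂τ)|
      ≤ (∑ a, ∑ c, ℓf a * ℓg c * R₂₁ a c B') * (‖m'‖ / θc)

/-- (L22) SECOND-ORDER RESPONSE OF THE SECOND CUMULANT on a window square (corners as in (L2), centring at the BASE means of `V00`):
`|ΔΔ_{BB′} E_{W ·}((f̂ − cf)(ĝ − cg))| ≤ (Σ_{a,c} ℓf a·ℓg c·R₂₂ a c B B′)·(‖m‖∕θc)·(‖m′‖∕θc)`. -/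
def Cum2Resp2Clause {P Q : Params} {Z : Type} [MeasurableSpace Z] (τ : Measure Z)
    (Φ : GaugeField P 0 ↥(Matrix.specialUnitaryGroup (Fin 2) ℂ) × Z → GaugeField Q 0 ↥(Matrix.specialUnitaryGroup (Fin 2) ℂ))
    (W : GaugeField P 0 ↥(Matrix.specialUnitaryGroup (Fin 2) ℂ) → Z → ℝ) (θc rc θf rf : ℝ)
    (R₂₂ : PBond Q 0 → PBond Q 0 → PBond P 0 → PBond P 0 → ℝ) : Prop :=
  ∀ (B B' : PBond P 0) (m m' : Fin 3 → ℝ) (V00 V10 V01 V11 : GaugeField P 0 ↥(Matrix.specialUnitaryGroup (Fin 2) ℂ)),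
    ‖m‖ ≤ rc * θc → ‖m'‖ ≤ rc * θc → PlaqSmall θc V00 → PlaqSmall θc V10 → PlaqSmall θc V01 → PlaqSmall θc V11 →
    (∀ e, e ≠ B → V10 e = V00 e) → V10 B = V00 B * expPt m → (∀ e, e ≠ B' → V01 e = V00 e) → V01 B' = V00 B' * expPt m' →
    (∀ e, e ≠ B' → V11 e = V10 e) → V11 B' = V10 B' * expPt m' →
  ∀ (f g : GaugeField Q 0 ↥(Matrix.specialUnitaryGroup (Fin 2) ℂ) → ℝ) (ℓf ℓg : PBond Q 0 → ℝ) (cf cg : ℝ),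
    Integrable (fun z => f (Φ (V00, z)) * W V00 z) τ → Integrable (fun z => g (Φ (V00, z)) * W V00 z) τ →
    cf = ∫ z, f (Φ (V00, z)) * W V00 z ∂τ → cg = ∫ z, g (Φ (V00, z)) * W V00 z ∂τ →
    Integrable (fun z => (f (Φ (V00, z)) - cf) * (g (Φ (V00, z)) - cg) * W V00 z) τ →
    Integrable (fun z => (f (Φ (V00, z)) - cf) * (g (Φ (V00, z)) - cg) * W V10 z) τ →
    Integrable (fun z => (f (Φ (V00, z)) - cf) * (g (Φ (V00, z)) - cg) * W V01 z) τ →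
    Integrable (fun z => (f (Φ (V00, z)) - cf) * (g (Φ (V00, z)) - cg) * W V11 z) τ →
    L2Row τ (fun z => Φ (V00, z)) (W V00) θf rf f ℓf → L2Row τ (fun z => Φ (V00, z)) (W V10) θf rf f ℓf →
    L2Row τ (fun z => Φ (V00, z)) (W V01) θf rf f ℓf → L2Row τ (fun z => Φ (V00, z)) (W V11) θf rf f ℓf →
    L2Row τ (fun z => Φ (V00, z)) (W V00) θf rf g ℓg → L2Row τ (fun z => Φ (V00, z)) (W V10) θf rf g ℓg →
    L2Row τ (fun z => Φ (V00, z)) (W V01) θf rf g ℓg → L2Row τ (fun z => Φ (V00, z)) (W V11) θf rf g ℓg →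
    |(∫ z, (f (Φ (V00, z)) - cf) * (g (Φ (V00, z)) - cg) * W V11 z ∂τ) - (∫ z, (f (Φ (V00, z)) - cf) * (g (Φ (V00, z)) - cg) * W V10 z ∂τ)
        - (∫ z, (f (Φ (V00, z)) - cf) * (g (Φ (V00, z)) - cg) * W V01 z ∂τ) + (∫ z, (f (Φ (V00, z)) - cf) * (g (Φ (V00, z)) - cg) * W V00 z ∂τ)|
      ≤ (∑ a, ∑ c, ℓf a * ℓg c * R₂₂ a c B B') * (‖m‖ / θc) * (‖m'‖ / θc)

/-! ## §3 The row -/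

/-- «SPREAD-FIBRE-LAW-H» v0.3k (def text = v0.3i with INT-CONCL: the 12 `Integrable` binders of (H) are conjuncts of the conclusions) — (H) = JOINT-TRANSPORT-H (JT-h) ∧ JOINT-RESPONSE-H (L1ʲ-h)(L2ʲ-h) for the pinned test functional `h_Ts = log ρ_Ts − log ρ′_Ts`, ∧ FIBRE-LAW-H
(S)(L0)(L1)(L2)(L21)(L22), on ONE shared fibred chart of `descendTo F ℰp j Ts` with a block projection `π` (module docstring). XL; NOT PRINTED as a theorem; a HYPOTHESIS row of the v18 H-line (feeds LEAD's LIN knit =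
w5 ✓`abs_fibreMean_secondDiff_le_response` brackets `A L₁ L₂ L₀`, and px5's JVAR/JEN knits; nothing in `Lines/` keys it). -/
def SpreadFibreLawH : Prop :=
  ∃ pW : ℝ, ∃ γ₁ : ℝ, 0 < γ₁ ∧ ∀ (F : T3Family) (γ : ℝ), 0 < γ → γ ≤ γ₁ → ∀ (b₀ p₀ : ℝ) (j₀ : ℕ) (prm : ℕ → ClassParams) (η : ℕ → ℝ) (rA : ℝ) (Bρ : ℕ → ℝ), 0 < b₀ → 0 < p₀ → pW ≤ p₀ → AdmissibleClassParams F γ b₀ p₀ prm → (∀ j, 0 ≤ η j) → Summable η → Summable (fun i => ∑' k, η (k + i)) → Tendsto (fun j => (∑' k, η (k + j)) * ((1 + 2 * ((F.L : ℝ) ^ j / γ) * (Fintype.card (Plaq (F.P j) 0) : ℝ)) * (Fintype.card (PBond (F.P j) 0) : ℝ) ^ 2)) atTop (𝓝 0) → 0 < rA → ∃ κ₀ : ℝ, 0 < κ₀ ∧ ∀ (κ : ℝ), 0 < κ → κ ≤ κ₀ → ∃ (rc rF w₀ NT NX NL CJ ND N1 N2 N21 N22 : ℝ) (ηin δT δX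 δL : ℕ → ℝ) (j₁ : ℕ), 0 < rc ∧ 0 < rF ∧ 0 < w₀ ∧ 0 ≤ NT ∧ 0 ≤ NX ∧ 0 ≤ NL ∧ 0 ≤ CJ ∧ 0 ≤ ND ∧ 0 ≤ N1 ∧ 0 ≤ N2 ∧ 0 ≤ N21 ∧ 0 ≤ N22 ∧ (∀ n, 0 ≤ ηin n) ∧ Summable (fun n => ηin n * (1 + ((F.L : ℝ) ^ n / γ) * (Fintype.card (Plaq (F.P n) 0) : ℝ) * (Fintype.card (PBond (F.P n) 0) : ℝ) ^ 2) ^ 4) ∧ (∀ n, 0 ≤ δT n ∧ 0 ≤ δX n ∧ 0 ≤ δL n) ∧ Summable δT ∧ Summable (fun i => ∑' k, δT (k + i)) ∧ Tendsto (fun j => (∑' k, δT (k + j)) * ((1 + 2 * ((F.L : ℝ) ^ j / γ) * (Fintype.card (Plaq (F.P j) 0) : ℝ)) * (Fintype.card (PBond (F.P j) 0) : ℝ) ^ 2)) atTop (𝓝 0) ∧ Summable δX ∧ Summable (fun i => ∑' k, δX (k + i)) ∧ Tendsto (fun j => (∑' k, δX (k + j)) * ((1 + 2 * ((F.L : ℝ)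 ^ j / γ) * (Fintype.card (Plaq (F.P j) 0) : ℝ)) * (Fintype.card (PBond (F.P j) 0) : ℝ) ^ 2)) atTop (𝓝 0) ∧ Summable δL ∧ Summable (fun i => ∑' k, δL (k + i)) ∧ Tendsto (fun j => (∑' k, δL (k + j)) * ((1 + 2 * ((F.L : ℝ) ^ j / γ) * (Fintype.card (Plaq (F.P j) 0) : ℝ)) * (Fintype.card (PBond (F.P j) 0) : ℝ) ^ 2)) atTop (𝓝 0) ∧ j₀ ≤ j₁ ∧ ∀ (ν : ℕ → (j : ℕ) → MeasureTheory.Measure (GaugeField (F.P j) 0 ↥(Matrix.specialUnitaryGroup (Fin 2) ℂ))), (∀ K, ν K K = T4GenFunBounds.gibbsMeasure (F.P K) ((F.scheme ℰp γ).β K)) → (∀ K j, j < K → ν K j = Measure.map (descend F ℰp j) (ν K (j + 1))) → ∀ (K K' : ℕ), K ≤ K' → ∀ (Ts T : ℕ), Ts < T → T ≤ K → ∀ (μ μ' : ((j : ℕ) → MeasureTheory.Measure (GaugeField (F.P j) 0 ↥(Matrix.specialUnitaryGroup (Fin 2) ℂ)))) (ρ ρ' : ((j : ℕ) → GaugeField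 (F.P j) 0 ↥(Matrix.specialUnitaryGroup (Fin 2) ℂ) → ℝ)), (∀ j : ℕ, Ts ≤ j → j ≤ T → μ j = ν K j ∧ μ' j = ν K' j) → (∀ j : ℕ, j < Ts → μ j = Measure.map (descend F ℰp j) ((μ (j + 1)).withDensity (fun U => ENNReal.ofReal ((∏ p : Plaq _ _, max 0 (min 1 ((24 / 25 * (θBal F.L γ b₀ p₀ (j + 1)) - dist1 (GaugeField.plaqHol U p)) / ((24 / 25 - 1 / 2) * (θBal F.L γ b₀ p₀ (j + 1))))))))) ∧ μ' j = Measure.map (descend F ℰp j) ((μ' (j + 1)).withDensity (fun U => ENNReal.ofReal ((∏ p : Plaq _ _, max 0 (min 1 ((24 / 25 * (θBal F.L γ b₀ p₀ (j + 1)) - dist1 (GaugeField.plaqHol U p)) / ((24 / 25 - 1 / 2) * (θBal F.L γ b₀ p₀ (j + 1)))))))))) → (∀ j : ℕ, Ts ≤ j → j < T → μ j = Measure.map (descend F ℰp j) (μ (j + 1)) ∧ μ' j = Measure.map (descend F ℰp j) (μ' (j + 1))) → (∀ j : ℕ, j ≤ T → IsFiniteMeasure (μ j) ∧ IsFiniteMeasure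 (μ' j)) → (∀ j : ℕ, j₀ ≤ j → j ≤ T → ((∀ U, PlaqSmall (θBal F.L γ b₀ p₀ j) U → 0 < ρ j U ∧ 0 < ρ' j U) ∧ μ j = (fieldMeasure _ _ _).withDensity (fun U => ENNReal.ofReal (ρ j U)) ∧ μ' j = (fieldMeasure _ _ _).withDensity (fun U => ENNReal.ofReal (ρ' j U)) ∧ (∃ κ : ℝ, MemAtHeight F ℰp j (prm j) (fun U => Real.exp κ * ρ j U)) ∧ (∃ κ : ℝ, MemAtHeight F ℰp j (prm j) (fun U => Real.exp κ * ρ' j U)) ∧ μ j {U | ¬ PlaqSmall (θBal F.L γ b₀ p₀ j) U} ≤ ENNReal.ofReal (η j) ∧ μ' j {U | ¬ PlaqSmall (θBal F.L γ b₀ p₀ j) U} ≤ ENNReal.ofReal (η j) ∧ (ContinuousOn (ρ j) {U | PlaqSmall (θBal F.L γ b₀ p₀ j) U} ∧ ContinuousOn (ρ' j) {U | PlaqSmall (θBal F.L γ b₀ p₀ j) U}) ∧ ((∀ (U : GaugeField _ _ ↥(Matrix.specialUnitaryGroup (Fin 2) ℂ)), PlaqSmall (49 / 50 * θBal F.L γ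 b₀ p₀ j) U → ∀ (b b' : PBond _ _) (v v' : Fin 3 → ℝ), ‖v‖ ≤ 1 → ‖v'‖ ≤ 1 → ∃ g : ℂ × ℂ → ℂ, DifferentiableOn ℂ g (Metric.ball (0 : ℂ) (rA * (49 / 50 * θBal F.L γ b₀ p₀ j)) ×ˢ Metric.ball (0 : ℂ) (rA * (49 / 50 * θBal F.L γ b₀ p₀ j))) ∧ (∀ (s t : ℝ) (V Z : GaugeField _ _ ↥(Matrix.specialUnitaryGroup (Fin 2) ℂ)), |s| < rA * (49 / 50 * θBal F.L γ b₀ p₀ j) → |t| < rA * (49 / 50 * θBal F.L γ b₀ p₀ j) → (∀ e, e ≠ b → V e = U e) → V b = U b * expPt (s • v) → (∀ e, e ≠ b' → Z e = V e) → Z b' = V b' * expPt (t • v') → g ((s : ℂ), (t : ℂ)) = (((Real.log (ρ j Z)) : ℝ) : ℂ)) ∧ ∀ z ∈ Metric.ball (0 : ℂ) (rA * (49 / 50 * θBal F.L γ b₀ p₀ j)) ×ˢ Metric.ball (0 : ℂ) (rA * (49 / 50 * θBal F.L γ b₀ p₀ j)), ‖g z - g 0‖ ≤ (Bρ j)) ∧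 (∀ (U : GaugeField _ _ ↥(Matrix.specialUnitaryGroup (Fin 2) ℂ)), PlaqSmall (49 / 50 * θBal F.L γ b₀ p₀ j) U → ∀ (b b' : PBond _ _) (v v' : Fin 3 → ℝ), ‖v‖ ≤ 1 → ‖v'‖ ≤ 1 → ∃ g : ℂ × ℂ → ℂ, DifferentiableOn ℂ g (Metric.ball (0 : ℂ) (rA * (49 / 50 * θBal F.L γ b₀ p₀ j)) ×ˢ Metric.ball (0 : ℂ) (rA * (49 / 50 * θBal F.L γ b₀ p₀ j))) ∧ (∀ (s t : ℝ) (V Z : GaugeField _ _ ↥(Matrix.specialUnitaryGroup (Fin 2) ℂ)), |s| < rA * (49 / 50 * θBal F.L γ b₀ p₀ j) → |t| < rA * (49 / 50 * θBal F.L γ b₀ p₀ j) → (∀ e, e ≠ b → V e = U e) → V b = U b * expPt (s • v) → (∀ e, e ≠ b' → Z e = V e) → Z b' = V b' * expPt (t • v') → g ((s : ℂ), (t : ℂ)) = (((Real.log (ρ' j Z)) : ℝ) : ℂ)) ∧ ∀ z ∈ Metric.ball (0 : ℂ) (rA * (49 / 50 * θBal F.L γ b₀ p₀ j)) ×ˢ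 Metric.ball (0 : ℂ) (rA * (49 / 50 * θBal F.L γ b₀ p₀ j)), ‖g z - g 0‖ ≤ (Bρ j))))) → ∀ (j : ℕ), j₁ ≤ j → ∀ (hjTs : j + 1 ≤ Ts), ∃ (Z : Type) (_ : MeasurableSpace Z) (τ : MeasureTheory.Measure Z) (Φ : GaugeField (F.P j) 0 ↥(Matrix.specialUnitaryGroup (Fin 2) ℂ) × Z → GaugeField (F.P Ts) 0 ↥(Matrix.specialUnitaryGroup (Fin 2) ℂ)) (J : GaugeField (F.P j) 0 ↥(Matrix.specialUnitaryGroup (Fin 2) ℂ) × Z → NNReal) (S : Set (GaugeField (F.P Ts) 0 ↥(Matrix.specialUnitaryGroup (Fin 2) ℂ))) (π : Site (F.P Ts) 0 → Site (F.P j) 0) (D : PBond (F.P Ts) 0 → PBond (F.P Ts) 0 → ℝ) (R₁ : PBond (F.P Ts) 0 → PBond (F.P j) 0 → ℝ) (R₂ : PBond (F.P Ts) 0 → PBond (F.P j) 0 → PBond (F.P j) 0 → ℝ) (R₂₁ : PBond (F.P Ts) 0 → PBond (F.P Ts) 0 → PBond (F.P j) 0 → ℝ) (R₂₂ : PBond (F.P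 Ts) 0 → PBond (F.P Ts) 0 → PBond (F.P j) 0 → PBond (F.P j) 0 → ℝ), MeasureTheory.IsProbabilityMeasure τ ∧ Measurable Φ ∧ Measurable J ∧ MeasurableSet S ∧ (∀ U : GaugeField (F.P Ts) 0 ↥(Matrix.specialUnitaryGroup (Fin 2) ℂ), (∀ (n : ℕ) (hjn : j + 1 ≤ n) (hnK : n ≤ Ts), PlaqSmall (24 / 25 * θBal F.L γ b₀ p₀ n) (descendTo F ℰp n Ts hnK U)) → U ∈ S) ∧ (∀ V z, descendTo F ℰp j Ts (Nat.le_of_succ_le hjTs) (Φ (V, z)) = V) ∧ (∀ A : Set (GaugeField (F.P j) 0 ↥(Matrix.specialUnitaryGroup (Fin 2) ℂ)), MeasurableSet A → (fieldMeasure (F.P Ts) 0 ↥(Matrix.specialUnitaryGroup (Fin 2) ℂ)).restrict (descendTo F ℰp j Ts (Nat.le_of_succ_le hjTs) ⁻¹' A ∩ S) = ((((fieldMeasure (F.P j) 0 ↥(Matrix.specialUnitaryGroup (Fin 2) ℂ)).restrict A).prod τ).withDensity (fun p => (J p : ENNReal))).map Φ) ∧ (∀ f : GaugeField (F.P Ts)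 0 ↥(Matrix.specialUnitaryGroup (Fin 2) ℂ) → ℝ, Continuous f → (∀ U, f U ≠ 0 → (∀ (n : ℕ) (hjn : j + 1 ≤ n) (hnK : n ≤ Ts), PlaqSmall (24 / 25 * θBal F.L γ b₀ p₀ n) (descendTo F ℰp n Ts hnK U))) → ∀ z, ContinuousOn (fun V => (J (V, z) : ℝ) * f (Φ (V, z))) {V | PlaqSmall (θBal F.L γ b₀ p₀ j) V}) ∧ (∀ V z, (J (V, z) : ℝ) ≤ CJ) ∧ (∀ V, PlaqSmall (θBal F.L γ b₀ p₀ j) V → 0 < ∫⁻ z in {z | (∀ (n : ℕ) (hjn : j + 1 ≤ n) (hnK : n ≤ Ts), PlaqSmall (24 / 25 * θBal F.L γ b₀ p₀ n) (descendTo F ℰp n Ts hnK (Φ (V, z))))}, (J (V, z) : ENNReal) ∂τ) ∧ (∀ x y : Site (F.P Ts) 0, (((π x).tdist (π y) : ℕ) : ℝ) ≤ ((x.tdist y : ℕ) : ℝ)) ∧ (∀ y : Site (F.P j) 0, ∃ s : Finset (Site (F.P Ts) 0), (∀ x, π x = y → x ∈ s) ∧ (s.card : ℝ) ≤ ((F.L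 : ℝ) ^ (Ts - j)) ^ 3) ∧ (∀ (k : PBond (F.P Ts) 0 → PBond (F.P Ts) 0 → ℝ) (w : ℝ), 0 ≤ w → w / (((F.L : ℝ) ^ Ts / γ) * θBal F.L γ b₀ p₀ Ts ^ 2) ≤ w₀ → (∀ b b', 0 ≤ k b b') → (∀ b, ∑ b', k b b' * Real.exp (κ * (b.src.tdist b'.src : ℝ)) ≤ w) → (∀ (b b' : PBond (F.P Ts) 0) (v v' : Fin 3 → ℝ) (U V W Y : GaugeField (F.P Ts) 0 ↥(Matrix.specialUnitaryGroup (Fin 2) ℂ)), ‖v‖ ≤ (rA / 2) * (θBal F.L γ b₀ p₀ Ts / 4) → ‖v'‖ ≤ (rA / 2) * (θBal F.L γ b₀ p₀ Ts / 4) → PlaqSmall (θBal F.L γ b₀ p₀ Ts / 4) U → PlaqSmall (θBal F.L γ b₀ p₀ Ts / 4) V → PlaqSmall (θBal F.L γ b₀ p₀ Ts / 4) W → PlaqSmall (θBal F.L γ b₀ p₀ Ts / 4) Y → (∀ e, e ≠ b → V e = U e) → V b = U b * expPt v → (∀ e, e ≠ b' → W e = U e) → W b' = U b' * expPt v' → (∀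 e, e ≠ b' → Y e = V e) → Y b' = V b' * expPt v' → |(Real.log (ρ Ts Y) - Real.log (ρ' Ts Y)) - (Real.log (ρ Ts V) - Real.log (ρ' Ts V)) - (Real.log (ρ Ts W) - Real.log (ρ' Ts W)) + (Real.log (ρ Ts U) - Real.log (ρ' Ts U))| ≤ k b b' * (‖v‖ / (θBal F.L γ b₀ p₀ Ts / 4)) * (‖v'‖ / (θBal F.L γ b₀ p₀ Ts / 4))) → (∀ t : ℝ, 0 ≤ t → t ≤ 1 → ∃ k' : PBond (F.P j) 0 → PBond (F.P j) 0 → ℝ, (∀ B B', 0 ≤ k' B B') ∧ (∀ B, ∑ B', k' B B' * Real.exp (κ * (B.src.tdist B'.src : ℝ)) ≤ NT * ((((F.L : ℝ) ^ j / γ) * θBal F.L γ b₀ p₀ j ^ 2) / (((F.L : ℝ) ^ Ts / γ) * θBal F.L γ b₀ p₀ Ts ^ 2)) * w + δT j * (((F.L : ℝ) ^ j / γ) * θBal F.L γ b₀ p₀ j ^ 2)) ∧ (∀ (B B' : PBond (F.P j) 0) (m m' : Fin 3 → ℝ) (U V W Y Xw : GaugeField (F.P j) 0 ↥(Matrix.specialUnitaryGroup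 (Fin 2) ℂ)), ‖m‖ ≤ rc * (θBal F.L γ b₀ p₀ j / 4) → ‖m'‖ ≤ rc * (θBal F.L γ b₀ p₀ j / 4) → PlaqSmall (θBal F.L γ b₀ p₀ j / 4) U → PlaqSmall (θBal F.L γ b₀ p₀ j / 4) V → PlaqSmall (θBal F.L γ b₀ p₀ j / 4) W → PlaqSmall (θBal F.L γ b₀ p₀ j / 4) Y → PlaqSmall (θBal F.L γ b₀ p₀ j / 4) Xw → (∀ e, e ≠ B → V e = U e) → V B = U B * expPt m → (∀ e, e ≠ B' → W e = U e) → W B' = U B' * expPt m' → (∀ e, e ≠ B' → Y e = V e) → Y B' = V B' * expPt m' → Integrable (fun z => (Real.log (ρ Ts (Φ (U, z))) - Real.log (ρ' Ts (Φ (U, z)))) * (wgt F γ b₀ p₀ j Ts ρ ρ' τ Φ J t) Xw z) τ ∧ Integrable (fun z => (Real.log (ρ Ts (Φ (V, z))) - Real.log (ρ' Ts (Φ (V, z)))) * (wgt F γ b₀ p₀ j Ts ρ ρ' τ Φ J t) Xw z) τ ∧ Integrable (fun z => (Real.log (ρ Ts (Φ (W, z))) - Real.log (ρ' Ts (Φ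 (W, z)))) * (wgt F γ b₀ p₀ j Ts ρ ρ' τ Φ J t) Xw z) τ ∧ Integrable (fun z => (Real.log (ρ Ts (Φ (Y, z))) - Real.log (ρ' Ts (Φ (Y, z)))) * (wgt F γ b₀ p₀ j Ts ρ ρ' τ Φ J t) Xw z) τ ∧ |∫ z, ((Real.log (ρ Ts (Φ (Y, z))) - Real.log (ρ' Ts (Φ (Y, z)))) - (Real.log (ρ Ts (Φ (V, z))) - Real.log (ρ' Ts (Φ (V, z)))) - (Real.log (ρ Ts (Φ (W, z))) - Real.log (ρ' Ts (Φ (W, z)))) + (Real.log (ρ Ts (Φ (U, z))) - Real.log (ρ' Ts (Φ (U, z))))) * (wgt F γ b₀ p₀ j Ts ρ ρ' τ Φ J t) Xw z ∂τ| ≤ k' B B' * (‖m‖ / (θBal F.L γ b₀ p₀ j / 4)) * (‖m'‖ / (θBal F.L γ b₀ p₀ j / 4)))) ∧ (∀ t : ℝ, 0 ≤ t → t ≤ 1 → ∃ kX : PBond (F.P j) 0 → PBond (F.P j) 0 → ℝ, (∀ B B', 0 ≤ kX B B') ∧ (∀ B, ∑ B', kX B B' * Real.exp (κ * (B.src.tdist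 B'.src : ℝ)) ≤ NX * ((((F.L : ℝ) ^ j / γ) * θBal F.L γ b₀ p₀ j ^ 2) / (((F.L : ℝ) ^ Ts / γ) * θBal F.L γ b₀ p₀ Ts ^ 2)) * w + δX j * (((F.L : ℝ) ^ j / γ) * θBal F.L γ b₀ p₀ j ^ 2)) ∧ (∀ B', ∑ B, kX B B' * Real.exp (κ * (B.src.tdist B'.src : ℝ)) ≤ NX * ((((F.L : ℝ) ^ j / γ) * θBal F.L γ b₀ p₀ j ^ 2) / (((F.L : ℝ) ^ Ts / γ) * θBal F.L γ b₀ p₀ Ts ^ 2)) * w + δX j * (((F.L : ℝ) ^ j / γ) * θBal F.L γ b₀ p₀ j ^ 2)) ∧ (∀ (B B' : PBond (F.P j) 0) (m m' : Fin 3 → ℝ) (U₁ V₁ U₂ W₂ : GaugeField (F.P j) 0 ↥(Matrix.specialUnitaryGroup (Fin 2) ℂ)), ‖m‖ ≤ rc * (θBal F.L γ b₀ p₀ j / 4) → ‖m'‖ ≤ rc * (θBal F.L γ b₀ p₀ j / 4) → PlaqSmall (θBal F.L γ b₀ p₀ j / 4) U₁ → PlaqSmall (θBal F.L γ b₀ p₀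 j / 4) V₁ → PlaqSmall (θBal F.L γ b₀ p₀ j / 4) U₂ → PlaqSmall (θBal F.L γ b₀ p₀ j / 4) W₂ → (∀ e, e ≠ B → V₁ e = U₁ e) → V₁ B = U₁ B * expPt m → (∀ e, e ≠ B' → W₂ e = U₂ e) → W₂ B' = U₂ B' * expPt m' → Integrable (fun z => (Real.log (ρ Ts (Φ (U₁, z))) - Real.log (ρ' Ts (Φ (U₁, z)))) * (wgt F γ b₀ p₀ j Ts ρ ρ' τ Φ J t) U₂ z) τ ∧ Integrable (fun z => (Real.log (ρ Ts (Φ (V₁, z))) - Real.log (ρ' Ts (Φ (V₁, z)))) * (wgt F γ b₀ p₀ j Ts ρ ρ' τ Φ J t) U₂ z) τ ∧ Integrable (fun z => (Real.log (ρ Ts (Φ (U₁, z))) - Real.log (ρ' Ts (Φ (U₁, z)))) * (wgt F γ b₀ p₀ j Ts ρ ρ' τ Φ J t) W₂ z) τ ∧ Integrable (fun z => (Real.log (ρ Ts (Φ (V₁, z))) - Real.log (ρ' Ts (Φ (V₁, z)))) * (wgt F γ b₀ p₀ j Ts ρ ρ' τ Φ J t) W₂ z) τ ∧ |((∫ z,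 (Real.log (ρ Ts (Φ (V₁, z))) - Real.log (ρ' Ts (Φ (V₁, z)))) * (wgt F γ b₀ p₀ j Ts ρ ρ' τ Φ J t) W₂ z ∂τ) - (∫ z, (Real.log (ρ Ts (Φ (U₁, z))) - Real.log (ρ' Ts (Φ (U₁, z)))) * (wgt F γ b₀ p₀ j Ts ρ ρ' τ Φ J t) W₂ z ∂τ)) - ((∫ z, (Real.log (ρ Ts (Φ (V₁, z))) - Real.log (ρ' Ts (Φ (V₁, z)))) * (wgt F γ b₀ p₀ j Ts ρ ρ' τ Φ J t) U₂ z ∂τ) - (∫ z, (Real.log (ρ Ts (Φ (U₁, z))) - Real.log (ρ' Ts (Φ (U₁, z)))) * (wgt F γ b₀ p₀ j Ts ρ ρ' τ Φ J t) U₂ z ∂τ))| ≤ kX B B' * (‖m‖ / (θBal F.L γ b₀ p₀ j / 4)) * (‖m'‖ / (θBal F.L γ b₀ p₀ j / 4)))) ∧ (∀ t : ℝ, 0 ≤ t → t ≤ 1 → ∃ kL : PBond (F.P j) 0 → PBond (F.P j) 0 → ℝ, (∀ B B', 0 ≤ kL B B') ∧ (∀ B, ∑ B', kL B B' * Real.exp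 (κ * (B.src.tdist B'.src : ℝ)) ≤ NL * ((((F.L : ℝ) ^ j / γ) * θBal F.L γ b₀ p₀ j ^ 2) / (((F.L : ℝ) ^ Ts / γ) * θBal F.L γ b₀ p₀ Ts ^ 2)) * w + δL j * (((F.L : ℝ) ^ j / γ) * θBal F.L γ b₀ p₀ j ^ 2)) ∧ (∀ (B B' : PBond (F.P j) 0) (m m' : Fin 3 → ℝ) (V00 V10 V01 V11 : GaugeField (F.P j) 0 ↥(Matrix.specialUnitaryGroup (Fin 2) ℂ)), ‖m‖ ≤ rc * (θBal F.L γ b₀ p₀ j / 4) → ‖m'‖ ≤ rc * (θBal F.L γ b₀ p₀ j / 4) → PlaqSmall (θBal F.L γ b₀ p₀ j / 4) V00 → PlaqSmall (θBal F.L γ b₀ p₀ j / 4) V10 → PlaqSmall (θBal F.L γ b₀ p₀ j / 4) V01 → PlaqSmall (θBal F.L γ b₀ p₀ j / 4) V11 → (∀ e, e ≠ B → V10 e = V00 e) → V10 B = V00 B * expPt m → (∀ e, e ≠ B' → V01 e = V00 e) → V01 B' = V00 B' * expPt m' → (∀ e, e ≠ B' → V11 e = V10 e) → V11 B' = V10 B'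 * expPt m' → Integrable (fun z => (Real.log (ρ Ts (Φ (V00, z))) - Real.log (ρ' Ts (Φ (V00, z)))) * (wgt F γ b₀ p₀ j Ts ρ ρ' τ Φ J t) V00 z) τ ∧ Integrable (fun z => (Real.log (ρ Ts (Φ (V00, z))) - Real.log (ρ' Ts (Φ (V00, z)))) * (wgt F γ b₀ p₀ j Ts ρ ρ' τ Φ J t) V10 z) τ ∧ Integrable (fun z => (Real.log (ρ Ts (Φ (V00, z))) - Real.log (ρ' Ts (Φ (V00, z)))) * (wgt F γ b₀ p₀ j Ts ρ ρ' τ Φ J t) V01 z) τ ∧ Integrable (fun z => (Real.log (ρ Ts (Φ (V00, z))) - Real.log (ρ' Ts (Φ (V00, z)))) * (wgt F γ b₀ p₀ j Ts ρ ρ' τ Φ J t) V11 z) τ ∧ |(∫ z, (Real.log (ρ Ts (Φ (V00, z))) - Real.log (ρ' Ts (Φ (V00, z)))) * (wgt F γ b₀ p₀ j Ts ρ ρ' τ Φ J t) V11 z ∂τ) - (∫ z, (Real.log (ρ Ts (Φ (V00, z))) - Real.log (ρ' Ts (Φ (V00, z)))) * (wgt F γ b₀ p₀ j Ts ρ ρ'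 τ Φ J t) V10 z ∂τ) - (∫ z, (Real.log (ρ Ts (Φ (V00, z))) - Real.log (ρ' Ts (Φ (V00, z)))) * (wgt F γ b₀ p₀ j Ts ρ ρ' τ Φ J t) V01 z ∂τ) + (∫ z, (Real.log (ρ Ts (Φ (V00, z))) - Real.log (ρ' Ts (Φ (V00, z)))) * (wgt F γ b₀ p₀ j Ts ρ ρ' τ Φ J t) V00 z ∂τ)| ≤ kL B B' * (‖m‖ / (θBal F.L γ b₀ p₀ j / 4)) * (‖m'‖ / (θBal F.L γ b₀ p₀ j / 4))))) ∧ (∀ a c, 0 ≤ D a c) ∧ (∀ a c, D a c ≤ ND * ((1 + ((a.src.tdist c.src : ℕ) : ℝ))⁻¹ * Real.exp (-(κ * (((π a.src).tdist (π c.src) : ℕ) : ℝ))))) ∧ (∀ c Bc, 0 ≤ R₁ c Bc) ∧ (∀ c Bc, R₁ c Bc ≤ N1 * Real.exp (-(κ * (((π c.src).tdist Bc.src : ℕ) : ℝ)))) ∧ (∀ c Bc Bc', 0 ≤ R₂ c Bc Bc') ∧ (∀ c Bc Bc', R₂ c Bc Bc' ≤ N2 * Real.exp (-(κ * (((π c.src).tdist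 Bc.src : ℕ) : ℝ))) * Real.exp (-(κ * (((π c.src).tdist Bc'.src : ℕ) : ℝ)))) ∧ (∀ a c Bc, 0 ≤ R₂₁ a c Bc) ∧ (∀ a c Bc, R₂₁ a c Bc ≤ N21 * ((1 + ((a.src.tdist c.src : ℕ) : ℝ))⁻¹ * Real.exp (-(κ * (((π a.src).tdist (π c.src) : ℕ) : ℝ)))) * Real.exp (-(κ * (((π c.src).tdist Bc.src : ℕ) : ℝ)))) ∧ (∀ a c Bc Bc', 0 ≤ R₂₂ a c Bc Bc') ∧ (∀ a c Bc Bc', R₂₂ a c Bc Bc' ≤ N22 * ((1 + ((a.src.tdist c.src : ℕ) : ℝ))⁻¹ * Real.exp (-(κ * (((π a.src).tdist (π c.src) : ℕ) : ℝ)))) * Real.exp (-(κ * (((π c.src).tdist Bc.src : ℕ) : ℝ))) * Real.exp (-(κ * (((π c.src).tdist Bc'.src : ℕ) : ℝ)))) ∧ (∀ t : ℝ, 0 ≤ t → t ≤ 1 → TailClause τ Φ (wgt F γ b₀ p₀ j Ts ρ ρ' τ Φ J t) (θBal F.L γ b₀ p₀ j / 4) (θBal F.L γ b₀ p₀ Ts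 / 8) (ηin Ts) ∧ CovClause τ Φ (wgt F γ b₀ p₀ j Ts ρ ρ' τ Φ J t) (θBal F.L γ b₀ p₀ j / 4) (θBal F.L γ b₀ p₀ Ts / 4) rF D ∧ Resp1Clause τ Φ (wgt F γ b₀ p₀ j Ts ρ ρ' τ Φ J t) (θBal F.L γ b₀ p₀ j / 4) rc (θBal F.L γ b₀ p₀ Ts / 4) rF R₁ ∧ Resp2Clause τ Φ (wgt F γ b₀ p₀ j Ts ρ ρ' τ Φ J t) (θBal F.L γ b₀ p₀ j / 4) rc (θBal F.L γ b₀ p₀ Ts / 4) rF R₂ ∧ Cum2Resp1Clause τ Φ (wgt F γ b₀ p₀ j Ts ρ ρ' τ Φ J t) (θBal F.L γ b₀ p₀ j / 4) rc (θBal F.L γ b₀ p₀ Ts / 4) rF R₂₁ ∧ Cum2Resp2Clause τ Φ (wgt F γ b₀ p₀ j Ts ρ ρ' τ Φ J t) (θBal F.L γ b₀ p₀ j / 4) rc (θBal F.L γ b₀ p₀ Ts / 4) rF R₂₂)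

end Summit.QuantumFields.YangMills.Cruxes.FluctuationComparisonRegPrIntL.FibreLawH

namespace Summit.QuantumFields.YangMills.Cruxes.FluctuationComparisonRegPrIntL.LinKnit

open MeasureTheory Filter Topology Function
open scoped ENNReal NNReal BigOperators
open Literature.MathematicalPhysics.QuantumFieldTheory.Balaban1983to89 T3ContinuumYM3Torus T3NestedUnitLaws
  T3UnitLawDensityEML T4Continuum BalabanUVClass T3UnitScaleTilt T3LevelShift T3TiltDescent
open T4CubeChartExp (expPt)
open Summit.QuantumFields.YangMills.Theorems.FluctuationComparisonRegPrIntLOrganTangentFibreMeanVersionMW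
open Summit.QuantumFields.YangMills.Theorems.FluctuationComparisonRegPrIntLOrganTangentAPackageDescendTo
open Summit.QuantumFields.YangMills.Cruxes.FluctuationComparisonRegPrIntL.FibreLawH
open Summit.QuantumFields.YangMills.Theorems.FluctuationComparisonRegPrIntLOrganTangentMultiWindowWeight (exists_height_multiWindowWeight)

/-- **LINᵘ-H″** — LIN′ (ws16 edc3b855215b4c15, BRICK 1 v2.1 ✓p810896's `hL`) with the `∃ pW … pW ≤ p₀ →` head of `SpreadFibreLawH` v0.3i
(ideator g28 №8 (c) TN-TAIL-P0; LEAD №25 (5)(c) YES); provisional text until v18.2 cuts LIN″.  A HYPOTHESIS schema; nothing asserted. -/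
def TangentUH2 : Prop :=
  ∃ pW : ℝ, ∃ γ₁ : ℝ, 0 < γ₁ ∧ ∀ (F : T3Family) (γ : ℝ), 0 < γ → γ ≤ γ₁ → ∀ (b₀ p₀ : ℝ) (j₀ : ℕ) (prm : ℕ → ClassParams) (η : ℕ → ℝ) (rA : ℝ) (Bρ : ℕ → ℝ), 0 < b₀ → 0 < p₀ → pW ≤ p₀ → AdmissibleClassParams F γ b₀ p₀ prm → (∀ j, 0 ≤ η j) → Summable η → Summable (fun i => ∑' k, η (k + i)) → Tendsto (fun j => (∑' k, η (k + j)) * ((1 + 2 * ((F.L : ℝ) ^ j / γ) * (Fintype.card (Plaq (F.P j) 0) : ℝ)) * (Fintype.card (PBond (F.P j) 0) : ℝ) ^ 2)) atTop (𝓝 0) → 0 < rA → ∃ κ₀ : ℝ, 0 < κ₀ ∧ ∀ (κ : ℝ), 0 < κ → κ ≤ κ₀ → ∃ (θ r Ctr w₀ : ℝ) (εd δ : ℕ → ℝ) (j₁ : ℕ), 0 < θ ∧ 0 < r ∧ 1 ≤ Ctr ∧ 0 < w₀ ∧ (∀ j, 0 ≤ εd j ∧ 0 ≤ δ j) ∧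 Summable εd ∧ Summable δ ∧ Summable (fun i => ∑' k, δ (k + i)) ∧ Tendsto (fun j => (∑' k, δ (k + j)) * ((1 + 2 * ((F.L : ℝ) ^ j / γ) * (Fintype.card (Plaq (F.P j) 0) : ℝ)) * (Fintype.card (PBond (F.P j) 0) : ℝ) ^ 2)) atTop (𝓝 0) ∧ j₀ ≤ j₁ ∧ ∀ (ν : ℕ → (j : ℕ) → MeasureTheory.Measure (GaugeField (F.P j) 0 ↥(Matrix.specialUnitaryGroup (Fin 2) ℂ))), (∀ K, ν K K = T4GenFunBounds.gibbsMeasure (F.P K) ((F.scheme ℰp γ).β K)) → (∀ K j, j < K → ν K j = Measure.map (descend F ℰp j) (ν K (j + 1))) → ∀ (K K' : ℕ), K ≤ K' → ∀ (Ts T : ℕ), Ts < T → T ≤ K → ∀ (μ μ' : ((j : ℕ) → MeasureTheory.Measure (GaugeField (F.P j) 0 ↥(Matrix.specialUnitaryGroup (Fin 2) ℂ)))) (ρ ρ' : ((j : ℕ) → GaugeField (F.P j) 0 ↥(Matrix.specialUnitaryGroup (Fin 2) ℂ) → ℝ)), (∀ j : ℕ, Ts ≤ j → j ≤ T → μ j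 = ν K j ∧ μ' j = ν K' j) → (∀ j : ℕ, j < Ts → μ j = Measure.map (descend F ℰp j) ((μ (j + 1)).withDensity (fun U => ENNReal.ofReal ((∏ p : Plaq _ _, max 0 (min 1 ((24 / 25 * (θBal F.L γ b₀ p₀ (j + 1)) - dist1 (GaugeField.plaqHol U p)) / ((24 / 25 - 1 / 2) * (θBal F.L γ b₀ p₀ (j + 1))))))))) ∧ μ' j = Measure.map (descend F ℰp j) ((μ' (j + 1)).withDensity (fun U => ENNReal.ofReal ((∏ p : Plaq _ _, max 0 (min 1 ((24 / 25 * (θBal F.L γ b₀ p₀ (j + 1)) - dist1 (GaugeField.plaqHol U p)) / ((24 / 25 - 1 / 2) * (θBal F.L γ b₀ p₀ (j + 1)))))))))) → (∀ j : ℕ, Ts ≤ j → j < T → μ j = Measure.map (descend F ℰp j) (μ (j + 1)) ∧ μ' j = Measure.map (descend F ℰp j) (μ' (j + 1))) → (∀ j : ℕ, j ≤ T → IsFiniteMeasure (μ j) ∧ IsFiniteMeasure (μ' j)) → (∀ j : ℕ, j₀ ≤ j → j ≤ T → ((∀ U, PlaqSmall (θBal F.L γ b₀ p₀ j) U → 0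 < ρ j U ∧ 0 < ρ' j U) ∧ μ j = (fieldMeasure _ _ _).withDensity (fun U => ENNReal.ofReal (ρ j U)) ∧ μ' j = (fieldMeasure _ _ _).withDensity (fun U => ENNReal.ofReal (ρ' j U)) ∧ (∃ κ : ℝ, MemAtHeight F ℰp j (prm j) (fun U => Real.exp κ * ρ j U)) ∧ (∃ κ : ℝ, MemAtHeight F ℰp j (prm j) (fun U => Real.exp κ * ρ' j U)) ∧ μ j {U | ¬ PlaqSmall (θBal F.L γ b₀ p₀ j) U} ≤ ENNReal.ofReal (η j) ∧ μ' j {U | ¬ PlaqSmall (θBal F.L γ b₀ p₀ j) U} ≤ ENNReal.ofReal (η j) ∧ (ContinuousOn (ρ j) {U | PlaqSmall (θBal F.L γ b₀ p₀ j) U} ∧ ContinuousOn (ρ' j) {U | PlaqSmall (θBal F.L γ b₀ p₀ j) U}) ∧ ((∀ (U : GaugeField _ _ ↥(Matrix.specialUnitaryGroup (Fin 2) ℂ)), PlaqSmall (49 / 50 * θBal F.L γ b₀ p₀ j) U → ∀ (b b' : PBond _ _) (v v' : Fin 3 → ℝ), ‖v‖ ≤ 1 → ‖v'‖ ≤ 1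 → ∃ g : ℂ × ℂ → ℂ, DifferentiableOn ℂ g (Metric.ball (0 : ℂ) (rA * (49 / 50 * θBal F.L γ b₀ p₀ j)) ×ˢ Metric.ball (0 : ℂ) (rA * (49 / 50 * θBal F.L γ b₀ p₀ j))) ∧ (∀ (s t : ℝ) (V Z : GaugeField _ _ ↥(Matrix.specialUnitaryGroup (Fin 2) ℂ)), |s| < rA * (49 / 50 * θBal F.L γ b₀ p₀ j) → |t| < rA * (49 / 50 * θBal F.L γ b₀ p₀ j) → (∀ e, e ≠ b → V e = U e) → V b = U b * expPt (s • v) → (∀ e, e ≠ b' → Z e = V e) → Z b' = V b' * expPt (t • v') → g ((s : ℂ), (t : ℂ)) = (((Real.log (ρ j Z)) : ℝ) : ℂ)) ∧ ∀ z ∈ Metric.ball (0 : ℂ) (rA * (49 / 50 * θBal F.L γ b₀ p₀ j)) ×ˢ Metric.ball (0 : ℂ) (rA * (49 / 50 * θBal F.L γ b₀ p₀ j)), ‖g z - g 0‖ ≤ (Bρ j)) ∧ (∀ (U : GaugeField _ _ ↥(Matrix.specialUnitaryGroup (Fin 2) ℂ)), PlaqSmall (49 / 50 * θBal F.L γ b₀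 p₀ j) U → ∀ (b b' : PBond _ _) (v v' : Fin 3 → ℝ), ‖v‖ ≤ 1 → ‖v'‖ ≤ 1 → ∃ g : ℂ × ℂ → ℂ, DifferentiableOn ℂ g (Metric.ball (0 : ℂ) (rA * (49 / 50 * θBal F.L γ b₀ p₀ j)) ×ˢ Metric.ball (0 : ℂ) (rA * (49 / 50 * θBal F.L γ b₀ p₀ j))) ∧ (∀ (s t : ℝ) (V Z : GaugeField _ _ ↥(Matrix.specialUnitaryGroup (Fin 2) ℂ)), |s| < rA * (49 / 50 * θBal F.L γ b₀ p₀ j) → |t| < rA * (49 / 50 * θBal F.L γ b₀ p₀ j) → (∀ e, e ≠ b → V e = U e) → V b = U b * expPt (s • v) → (∀ e, e ≠ b' → Z e = V e) → Z b' = V b' * expPt (t • v') → g ((s : ℂ), (t : ℂ)) = (((Real.log (ρ' j Z)) : ℝ) : ℂ)) ∧ ∀ z ∈ Metric.ball (0 : ℂ) (rA * (49 / 50 * θBal F.L γ b₀ p₀ j)) ×ˢ Metric.ball (0 : ℂ) (rA * (49 / 50 * θBal F.L γ b₀ p₀ j)), ‖g z - g 0‖ ≤ (Bρ j))))) → ∀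 (w : ℝ), 0 ≤ w → w / (((F.L : ℝ) ^ Ts / γ) * θBal F.L γ b₀ p₀ Ts ^ 2) ≤ w₀ → (∃ k : PBond (F.P Ts) 0 → PBond (F.P Ts) 0 → ℝ, (∀ b b', 0 ≤ k b b') ∧ (∀ b, ∑ b', k b b' * Real.exp (κ * (b.src.tdist b'.src : ℝ)) ≤ w) ∧ (∀ (b b' : PBond _ _) (v v' : Fin 3 → ℝ) (U V W Z : GaugeField _ _ ↥(Matrix.specialUnitaryGroup (Fin 2) ℂ)), ‖v‖ ≤ (rA / 2) * (θBal F.L γ b₀ p₀ Ts / 4) → ‖v'‖ ≤ (rA / 2) * (θBal F.L γ b₀ p₀ Ts / 4) → PlaqSmall (θBal F.L γ b₀ p₀ Ts / 4) U → PlaqSmall (θBal F.L γ b₀ p₀ Ts / 4) V → PlaqSmall (θBal F.L γ b₀ p₀ Ts / 4) W → PlaqSmall (θBal F.L γ b₀ p₀ Ts / 4) Z → (∀ e, e ≠ b → V e = U e) → V b = U b * expPt v → (∀ e, e ≠ b' → W e = U e) → W b' = U b' * expPt v' → (∀ e, e ≠ b' → Z e = V e) → Z b' = V b' * expPt v' →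 |(Real.log (ρ Ts Z) - Real.log (ρ' Ts Z)) - (Real.log (ρ Ts V) - Real.log (ρ' Ts V)) - (Real.log (ρ Ts W) - Real.log (ρ' Ts W)) + (Real.log (ρ Ts U) - Real.log (ρ' Ts U))| ≤ k b b' * (‖v‖ / (θBal F.L γ b₀ p₀ Ts / 4)) * (‖v'‖ / (θBal F.L γ b₀ p₀ Ts / 4)))) → ∀ (j : ℕ), j₁ ≤ j → ∀ (hjTs : j + 1 ≤ Ts), ∀ (σ : ProbabilityTheory.Kernel (GaugeField (F.P j) 0 ↥(Matrix.specialUnitaryGroup (Fin 2) ℂ)) (GaugeField (F.P Ts) 0 ↥(Matrix.specialUnitaryGroup (Fin 2) ℂ))), ProbabilityTheory.IsMarkovKernel σ → (Measure.map (descendTo F ℰp j Ts (Nat.le_of_succ_le hjTs)) (fieldMeasure (F.P Ts) 0 ↥(Matrix.specialUnitaryGroup (Fin 2) ℂ))).bind ⇑σ = fieldMeasure (F.P Ts) 0 ↥(Matrix.specialUnitaryGroup (Fin 2) ℂ) → (∀ᵐ V ∂(Measure.map (descendTo F ℰp j Ts (Nat.le_of_succ_le hjTs)) (fieldMeasure (F.P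 Ts) 0 ↥(Matrix.specialUnitaryGroup (Fin 2) ℂ))), ∀ᵐ U ∂(σ V), descendTo F ℰp j Ts (Nat.le_of_succ_le hjTs) U = V) → ∀ (mfun : GaugeField (F.P j) 0 ↥(Matrix.specialUnitaryGroup (Fin 2) ℂ) → ℝ), ContinuousOn mfun {V | PlaqSmall (θBal F.L γ b₀ p₀ j) V} → (∀ᵐ V ∂(fieldMeasure (F.P j) 0 ↥(Matrix.specialUnitaryGroup (Fin 2) ℂ)), PlaqSmall (θBal F.L γ b₀ p₀ j) V → MeasureTheory.Integrable (fun U => (∏ i ∈ Finset.range (Ts - j), (if h : j + 1 + i ≤ Ts then (∏ p : Plaq (F.P (j + 1 + i)) 0, max 0 (min 1 ((24 / 25 * θBal F.L γ b₀ p₀ (j + 1 + i) - dist1 (GaugeField.plaqHol (descendTo F ℰp (j + 1 + i) Ts h U) p)) / ((24 / 25 - 1 / 2) * θBal F.L γ b₀ p₀ (j + 1 + i))))) else 1)) * (Real.log (ρ Ts U) - Real.log (ρ' Ts U)) * ρ' Ts U) (σ V) ∧ mfun V = (∫ U, (∏ i ∈ Finset.range (Ts - j), (if h : j + 1 + i ≤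 Ts then (∏ p : Plaq (F.P (j + 1 + i)) 0, max 0 (min 1 ((24 / 25 * θBal F.L γ b₀ p₀ (j + 1 + i) - dist1 (GaugeField.plaqHol (descendTo F ℰp (j + 1 + i) Ts h U) p)) / ((24 / 25 - 1 / 2) * θBal F.L γ b₀ p₀ (j + 1 + i))))) else 1)) * (Real.log (ρ Ts U) - Real.log (ρ' Ts U)) * ρ' Ts U ∂(σ V)) / (∫ U, (∏ i ∈ Finset.range (Ts - j), (if h : j + 1 + i ≤ Ts then (∏ p : Plaq (F.P (j + 1 + i)) 0, max 0 (min 1 ((24 / 25 * θBal F.L γ b₀ p₀ (j + 1 + i) - dist1 (GaugeField.plaqHol (descendTo F ℰp (j + 1 + i) Ts h U) p)) / ((24 / 25 - 1 / 2) * θBal F.L γ b₀ p₀ (j + 1 + i))))) else 1)) * ρ' Ts U ∂(σ V))) → ∃ (c' : Plaq (F.P j) 0 → ℝ) (a' w' : ℝ), 0 ≤ a' ∧ 0 ≤ w' ∧ a' + θ * (w' / (((F.L : ℝ) ^ j / γ) * θBal F.L γ b₀ p₀ j ^ 2)) ≤ (Ctr + εd (T - (Ts + 1))) * (w / (((F.L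 : ℝ) ^ Ts / γ) * θBal F.L γ b₀ p₀ Ts ^ 2)) + δ j ∧ (∀ p, |c' p| ≤ a') ∧ ∃ k' : PBond (F.P j) 0 → PBond (F.P j) 0 → ℝ, (∀ b b', 0 ≤ k' b b') ∧ (∀ b, ∑ b', k' b b' * Real.exp (κ * (b.src.tdist b'.src : ℝ)) ≤ w') ∧ (∀ (b b' : PBond _ _) (v v' : Fin 3 → ℝ) (U V W Z : GaugeField _ _ ↥(Matrix.specialUnitaryGroup (Fin 2) ℂ)), ‖v‖ ≤ r * (θBal F.L γ b₀ p₀ j / 4) → ‖v'‖ ≤ r * (θBal F.L γ b₀ p₀ j / 4) → PlaqSmall (θBal F.L γ b₀ p₀ j / 4) U → PlaqSmall (θBal F.L γ b₀ p₀ j / 4) V → PlaqSmall (θBal F.L γ b₀ p₀ j / 4) W → PlaqSmall (θBal F.L γ b₀ p₀ j / 4) Z → (∀ e, e ≠ b → V e = U e) → V b = U b * expPt v → (∀ e, e ≠ b' → W e = U e) → W b' = U b' * expPt v' → (∀ e, e ≠ b' → Z e = V e) → Z b' = V b' * expPt v' → |(mfun Z - ((F.L : ℝ) ^ j / γ) *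 ∑ p, c' p * (1 - reTr (GaugeField.plaqHol Z p))) - (mfun V - ((F.L : ℝ) ^ j / γ) * ∑ p, c' p * (1 - reTr (GaugeField.plaqHol V p))) - (mfun W - ((F.L : ℝ) ^ j / γ) * ∑ p, c' p * (1 - reTr (GaugeField.plaqHol W p))) + (mfun U - ((F.L : ℝ) ^ j / γ) * ∑ p, c' p * (1 - reTr (GaugeField.plaqHol U p)))| ≤ k' b b' * (‖v‖ / (θBal F.L γ b₀ p₀ j / 4)) * (‖v'‖ / (θBal F.L γ b₀ p₀ j / 4)))


/-- kernel: the ℓ¹ torus step distance is symmetric. [folklore] -/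
private theorem tdist_comm' {P : Params} {i : ℕ} (x y : Site P i) : Site.tdist x y = Site.tdist y x := by
  unfold Site.tdist
  exact Finset.sum_congr rfl fun μ _ => min_comm _ _

open Summit.QuantumFields.YangMills.Theorems.OrganTangentGaugeConjugateProbe (conj_expPt norm_adVec_le) in
/-- THE FOURTH CORNER'S LAW EDGE: in a one-bond square `V = U^{b,v}`, `W = U^{b′,v′}`, `Y = V^{b′,v′}` the far corner is reached from `W` by a
one-bond move at `b` of a vector of size `≤ √3·‖v‖` (`= v` if `b ≠ b′`; the `e^{−v′}`-conjugate of `v` if `b = b′`, by ✓`conj_expPt`). [folklore] -/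
theorem fourthCorner_lawEdge {P : Params} [DecidableEq (PBond P 0)]
    (U V W Y : GaugeField P 0 ↥(Matrix.specialUnitaryGroup (Fin 2) ℂ)) (b b' : PBond P 0) (v v' : Fin 3 → ℝ)
    (hVU : ∀ e, e ≠ b → V e = U e) (hVb : V b = U b * expPt v) (hWU : ∀ e, e ≠ b' → W e = U e)
    (hWb : W b' = U b' * expPt v') (hYV : ∀ e, e ≠ b' → Y e = V e) (hYb : Y b' = V b' * expPt v') :
    ∃ m : Fin 3 → ℝ, ‖m‖ ≤ Real.sqrt 3 * ‖v‖ ∧ (∀ e, e ≠ b → Y e = W e) ∧ Y b = W b * expPt m := by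
  by_cases hb : b = b'
  · subst hb
    refine ⟨WithLp.ofLp (B15Prop1ChartSU2.adSU2 (expPt v')⁻¹ (T4CubeChartExp.toE v)), norm_adVec_le _ _, fun e he => ?_, ?_⟩
    · rw [hYV e he, hVU e he, hWU e he]
    · rw [← conj_expPt, inv_inv, hYb, hVb, hWb]
      simp only [mul_assoc, mul_inv_cancel_left]
  · refine ⟨v, ?_, fun e he => ?_, ?_⟩
    · have h1 : (1 : ℝ) ≤ Real.sqrt 3 := by
        rw [show (1 : ℝ) = Real.sqrt 1 by simp]; exact Real.sqrt_le_sqrt (by norm_num)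
      nlinarith [norm_nonneg v]
    · by_cases he' : e = b'
      · subst he'; rw [hYb, hVU e he, hWb]
      · rw [hYV e he', hVU e he, hWU e he']
    · rw [hYV b hb, hVb, hWU b hb]

/-- kernel: the four-corner re-bracketing behind ✓R2b, as a RING identity in the nine basic integrals `I a c := ∫ F_a·ŵ_c`. [folklore] -/
private theorem rebracket (IYY IVV IWW IUU IVY IWY IUY IUV IUW : ℝ) :
    IYY - IVV - IWW + IUU = (IYY - IVY - IWY + IUY) + ((IVY - IUY) - (IVV - IUV)) + ((IWY - IUY) - (IWW - IUW))
      + (IUY - IUV - IUW + IUU) := by ring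

/-- kernel: a four-term combination against one weight, as four basic integrals. [folklore] -/
private theorem integral_comb4_mul {Z : Type*} [MeasurableSpace Z] (τ : Measure Z) (a b c d w : Z → ℝ)
    (ha : Integrable (fun z => a z * w z) τ) (hb : Integrable (fun z => b z * w z) τ)
    (hc : Integrable (fun z => c z * w z) τ) (hd : Integrable (fun z => d z * w z) τ) :
    ∫ z, (a z - b z - c z + d z) * w z ∂τ
      = (∫ z, a z * w z ∂τ) - (∫ z, b z * w z ∂τ) - (∫ z, c z * w z ∂τ) + ∫ z, d z * w z ∂τ := by
  have h1 : Integrable (fun z => a z * w z - b z * w z) τ := ha.sub hb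
  have h2 : Integrable (fun z => a z * w z - b z * w z - c z * w z) τ := h1.sub hc
  have e : ∀ z, (a z - b z - c z + d z) * w z = a z * w z - b z * w z - c z * w z + d z * w z := fun z => by ring
  simp_rw [e]
  rw [integral_add h2 hd, integral_sub h1 hc, integral_sub ha hb]

/-- kernel: `|a + b + c + d| ≤ |a| + |b| + |c| + |d|`. [folklore] -/
private theorem abs_add_four (a b c d : ℝ) : |a + b + c + d| ≤ |a| + |b| + |c| + |d| :=
  (abs_add_le _ _).trans (add_le_add ((abs_add_le _ _).trans (add_le_add (abs_add_le _ _) le_rfl)) le_rfl)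

/-- ★ **THE LIN KNIT** (scratch): `SpreadFibreLawH → LINᵘ-H″`.  [folklore] bookkeeping over hypothesis texts. -/
theorem tangentH_of_spreadFibreLawH (hF : SpreadFibreLawH) : TangentUH2 := by
  classical
  unfold TangentUH2
  obtain ⟨pW, γF, hγF, hF⟩ := hF
  refine ⟨pW, min γF 1, lt_min hγF one_pos, ?_⟩
  intro F γ hγ hγ1 b₀ p₀ j₀ prm η rA Bρ hb₀ hp₀ hpW hadm hη0 hηs hηss hηt hrA
  have hγone : γ ≤ 1 := hγ1.trans (min_le_right _ _)
  obtain ⟨κ₀, hκ₀, hF⟩ := hF F γ hγ (hγ1.trans (min_le_left _ _)) b₀ p₀ j₀ prm η rA Bρ hb₀ hp₀ hpW hadm hη0 hηs hηss hηt hrA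
  refine ⟨κ₀, hκ₀, ?_⟩
  intro κ hκ hκle
  obtain ⟨rc, rF, w₀, NT, NX, NL, CJ, ND, N1, N2, N21, N22, ηin, δT, δX, δL, j₁, hrc, hrF, hw₀, hNT, hNX, hNL, hCJ, hND,
    hN1, hN2, hN21, hN22, hηin0, hηins, hδ0, hδTs, hδTss, hδTt, hδXs, hδXss, hδXt, hδLs, hδLss, hδLt, hj₁, hF⟩ := hF κ hκ hκle
  -- the multi-window cut's height (✓exists_height_multiWindowWeight)
  obtain ⟨jA, hMWA⟩ := exists_height_multiWindowWeight F γ b₀ p₀ hγ hγone hb₀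
  -- LIN's package: θ := 1, r := rc/2, Ctr := max 1 (NT + 3NX + NL), w₀ := w₀, εd := 0, δ := δT + 3δX + δL, j₁ := max j₁ jA
  have hT : ∀ i, Summable (fun k => δT (k + i)) := fun i => (summable_nat_add_iff i).mpr hδTs
  have hX : ∀ i, Summable (fun k => δX (k + i)) := fun i => (summable_nat_add_iff i).mpr hδXs
  have hL : ∀ i, Summable (fun k => δL (k + i)) := fun i => (summable_nat_add_iff i).mpr hδLs
  have htsum : ∀ i, (∑' k, (δT (k + i) + 3 * δX (k + i) + δL (k + i)))
      = (∑' k, δT (k + i)) + 3 * (∑' k, δX (k + i)) + ∑' k, δL (k + i) := by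
    intro i
    rw [((hT i).add ((hX i).mul_left 3)).tsum_add (hL i), (hT i).tsum_add ((hX i).mul_left 3), tsum_mul_left]
  refine ⟨1, rc / 2, max 1 (NT + 3 * NX + NL), w₀, fun _ => 0, fun n => δT n + 3 * δX n + δL n, max j₁ jA,
    one_pos, half_pos hrc, le_max_left _ _, hw₀, ?_, summable_zero, (hδTs.add (hδXs.mul_left 3)).add hδLs, ?_, ?_, hj₁.trans (le_max_left _ _), ?_⟩
  · intro n
    exact ⟨le_rfl, add_nonneg (add_nonneg (hδ0 n).1 (mul_nonneg (by norm_num : (0:ℝ) ≤ 3) (hδ0 n).2.1)) (hδ0 n).2.2⟩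
  · have key : (fun i => ∑' k, (δT (k + i) + 3 * δX (k + i) + δL (k + i)))
        = fun i => (∑' k, δT (k + i)) + 3 * (∑' k, δX (k + i)) + ∑' k, δL (k + i) := funext htsum
    rw [key]
    exact (hδTss.add (hδXss.mul_left 3)).add hδLss
  · have key : (fun j => (∑' k, (δT (k + j) + 3 * δX (k + j) + δL (k + j))) * ((1 + 2 * ((F.L : ℝ) ^ j / γ)
          * (Fintype.card (Plaq (F.P j) 0) : ℝ)) * (Fintype.card (PBond (F.P j) 0) : ℝ) ^ 2))
        = fun j => (∑' k, δT (k + j)) * ((1 + 2 * ((F.L : ℝ) ^ j / γ) * (Fintype.card (Plaq (F.P j) 0) : ℝ))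
            * (Fintype.card (PBond (F.P j) 0) : ℝ) ^ 2)
          + 3 * ((∑' k, δX (k + j)) * ((1 + 2 * ((F.L : ℝ) ^ j / γ) * (Fintype.card (Plaq (F.P j) 0) : ℝ))
            * (Fintype.card (PBond (F.P j) 0) : ℝ) ^ 2))
          + (∑' k, δL (k + j)) * ((1 + 2 * ((F.L : ℝ) ^ j / γ) * (Fintype.card (Plaq (F.P j) 0) : ℝ))
            * (Fintype.card (PBond (F.P j) 0) : ℝ) ^ 2) := by
      funext j; rw [htsum j]; ring
    rw [key]
    simpa using (hδTt.add (hδXt.const_mul 3)).add hδLt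
  · intro ν hG hCν K K' hKK' Ts T hTs hTK μ μ' ρ ρ' hanch hcut hcons hfin hwin w hw0 hwle hseed j hj hjTs σ hσM hσb hσf
      mfun hmc hmae
    have hj1 : j₁ ≤ j := (le_max_left _ _).trans hj
    have hjA : jA ≤ j := (le_max_right _ _).trans hj
    -- the stride's chart and clauses
    obtain ⟨Z, instZ, τ, Φ, J, S, π, D, R₁, R₂, R₂₁, R₂₂, hτ, hΦm, hJm, hSm, hS, hsec, hdis, hcont, hJle, hpos, hπ1, hπ2, hH, hlaw⟩ :=
      hF ν hG hCν K K' hKK' Ts T hTs hTK μ μ' ρ ρ' hanch hcut hcons hfin hwin j hj1 hjTs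
    obtain ⟨k, hk0, hkrow, hksq⟩ := hseed
    obtain ⟨hJT, hL1, hL2⟩ := hH k w hw0 hwle hk0 hkrow hksq
    obtain ⟨k', hk'0, hk'row, hA⟩ := hJT 0 le_rfl zero_le_one
    obtain ⟨kX, hkX0, hkXrow, hkXcol, hLX⟩ := hL1 0 le_rfl zero_le_one
    obtain ⟨kL, hkL0, hkLrow, hL0⟩ := hL2 0 le_rfl zero_le_one
    -- the units
    have hLpos : (0 : ℝ) < (F.L : ℝ) := by exact_mod_cast (lt_trans zero_lt_one F.hL.2)
    have hθj : 0 < θBal F.L γ b₀ p₀ j := T3MinimiserStabilityReduction.θBal_pos F.hL.2.le hγ hγone hb₀ p₀ j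
    have hθT : 0 < θBal F.L γ b₀ p₀ Ts := T3MinimiserStabilityReduction.θBal_pos F.hL.2.le hγ hγone hb₀ p₀ Ts
    have hDj : 0 < ((F.L : ℝ) ^ j / γ) * θBal F.L γ b₀ p₀ j ^ 2 := mul_pos (div_pos (pow_pos hLpos j) hγ) (pow_pos hθj 2)
    have hDT : 0 < ((F.L : ℝ) ^ Ts / γ) * θBal F.L γ b₀ p₀ Ts ^ 2 := mul_pos (div_pos (pow_pos hLpos Ts) hγ) (pow_pos hθT 2)
    have hx0 : 0 ≤ w / (((F.L : ℝ) ^ Ts / γ) * θBal F.L γ b₀ p₀ Ts ^ 2) := div_nonneg hw0 hDT.le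
    -- STEP 2 (σ-version = chart fibre mean on the window): ✓SigmaVersionChartMean.sigmaVersion_eq_chartRatio + the `wgt₀` spelling
    have hTs₀ : j₀ ≤ Ts := by omega
    have hTsT : Ts ≤ T := hTs.le
    have hposT : ∀ U, PlaqSmall (θBal F.L γ b₀ p₀ Ts) U → 0 < ρ Ts U ∧ 0 < ρ' Ts U := fun U hU => (hwin Ts hTs₀ hTsT).1 U hU
    have hcT : ContinuousOn (ρ Ts) {U | PlaqSmall (θBal F.L γ b₀ p₀ Ts) U} := (hwin Ts hTs₀ hTsT).2.2.2.2.2.2.2.1.1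
    have hcT' : ContinuousOn (ρ' Ts) {U | PlaqSmall (θBal F.L γ b₀ p₀ Ts) U} := (hwin Ts hTs₀ hTsT).2.2.2.2.2.2.2.1.2
    have hmeasT : ∀ (f : GaugeField (F.P Ts) 0 ↥(Matrix.specialUnitaryGroup (Fin 2) ℂ) → ℝ),
        (∃ κ' : ℝ, MemAtHeight F ℰp Ts (prm Ts) (fun U => Real.exp κ' * f U)) → Measurable f := by
      intro f ⟨κ', hκ'⟩
      have hm1 : Measurable (fun U => Real.exp κ' * f U) := hκ'.measurable
      have hm2 : f = fun U => (Real.exp κ')⁻¹ * (Real.exp κ' * f U) := by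
        funext U; rw [← mul_assoc, inv_mul_cancel₀ (Real.exp_pos κ').ne', one_mul]
      rw [hm2]; exact hm1.const_mul _
    have hρm : Measurable (ρ Ts) := hmeasT _ (hwin Ts hTs₀ hTsT).2.2.2.1
    have hρ'm : Measurable (ρ' Ts) := hmeasT _ (hwin Ts hTs₀ hTsT).2.2.2.2.1
    obtain ⟨hχc, hχ0, hχsupp, hχpos⟩ := hMWA j hjA Ts hjTs
    haveI : BorelSpace (GaugeField (F.P Ts) 0 ↥(Matrix.specialUnitaryGroup (Fin 2) ℂ)) :=
      Literature.MathematicalPhysics.QuantumFieldTheory.Balaban1983to89.T3OrbitAverage.instBorelSpaceGaugeField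
    have hχm := hχc.measurable
    haveI := hσM
    haveI := hτ
    have hmae' : ∀ᵐ V ∂(fieldMeasure (F.P j) 0 ↥(Matrix.specialUnitaryGroup (Fin 2) ℂ)), PlaqSmall (θBal F.L γ b₀ p₀ j) V →
        mfun V = (∫ U, (fun U : GaugeField (F.P Ts) 0 ↥(Matrix.specialUnitaryGroup (Fin 2) ℂ) => ∏ i ∈ Finset.range (Ts - j), (if h : j + 1 + i ≤ Ts then (∏ p : Plaq (F.P (j + 1 + i)) 0, max 0 (min 1 ((24 / 25 * θBal F.L γ b₀ p₀ (j + 1 + i) - dist1 (GaugeField.plaqHol (descendTo F ℰp (j + 1 + i) Ts h U) p)) / ((24 / 25 - 1 / 2) * θBal F.L γ b₀ p₀ (j + 1 + i))))) else 1)) U * (Real.log (ρ Ts U) - Real.log (ρ' Ts U)) * ρ' Ts U ∂(σ V)) / (∫ U, (fun U : GaugeField (F.P Ts) 0 ↥(Matrix.specialUnitaryGroup (Fin 2) ℂ) => ∏ i ∈ Finset.range (Ts - j), (if h : j + 1 + i ≤ Ts then (∏ p : Plaq (F.P (j + 1 + i)) 0, max 0 (min 1 ((24 / 25 * θBal F.L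 γ b₀ p₀ (j + 1 + i) - dist1 (GaugeField.plaqHol (descendTo F ℰp (j + 1 + i) Ts h U) p)) / ((24 / 25 - 1 / 2) * θBal F.L γ b₀ p₀ (j + 1 + i))))) else 1)) U * ρ' Ts U ∂(σ V)) :=
      hmae.mono fun V h hV => (h hV).2
    have hSV := Summit.QuantumFields.YangMills.Theorems.OrganTangentSigmaVersionChartMean.sigmaVersion_eq_chartRatio F γ b₀ p₀ j Ts hjTs
      (ρ Ts) (ρ' Ts) hρm hρ'm hcT hcT' hposT hθT (fun U : GaugeField (F.P Ts) 0 ↥(Matrix.specialUnitaryGroup (Fin 2) ℂ) => ∏ i ∈ Finset.range (Ts - j), (if h : j + 1 + i ≤ Ts then (∏ p : Plaq (F.P (j + 1 + i)) 0, max 0 (min 1 ((24 / 25 * θBal F.L γ b₀ p₀ (j + 1 + i) - dist1 (GaugeField.plaqHol (descendTo F ℰp (j + 1 + i) Ts h U) p)) / ((24 / 25 - 1 / 2) * θBal F.L γ b₀ p₀ (j + 1 + i))))) else 1)) hχc hχm hχ0 hχsupp hχpos σ hσb hσf mfun hmc hmae' τ Φ J S hΦm hJm hSm hS hdis hcont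
      CJ hJle hpos
    have hrep : ∀ V, PlaqSmall (θBal F.L γ b₀ p₀ j / 4) V →
        mfun V = ∫ z, (Real.log (ρ Ts (Φ (V, z))) - Real.log (ρ' Ts (Φ (V, z)))) * (wgt F γ b₀ p₀ j Ts ρ ρ' τ Φ J 0) V z ∂τ := by
      intro V hV4
      have hV : PlaqSmall (θBal F.L γ b₀ p₀ j) V := fun p => (hV4 p).trans_le (by linarith [hθj.le])
      obtain ⟨hM, hEq⟩ := hSV V hV
      rw [hEq]
      have hnum : ∀ z, (fun U : GaugeField (F.P Ts) 0 ↥(Matrix.specialUnitaryGroup (Fin 2) ℂ) => ∏ i ∈ Finset.range (Ts - j), (if h : j + 1 + i ≤ Ts then (∏ p : Plaq (F.P (j + 1 + i)) 0, max 0 (min 1 ((24 / 25 * θBal F.L γ b₀ p₀ (j + 1 + i) - dist1 (GaugeField.plaqHol (descendTo F ℰp (j + 1 + i) Ts h U) p)) / ((24 / 25 - 1 / 2) * θBal F.L γ b₀ p₀ (j + 1 + i))))) else 1)) (Φ (V, z)) * (Real.log (ρ Ts (Φ (V, z))) - Real.log (ρ' Ts (Φ (V, z)))) * ρ' Ts (Φ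 (V, z)) * (J (V, z) : ℝ)
          = (Real.log (ρ Ts (Φ (V, z))) - Real.log (ρ' Ts (Φ (V, z)))) * ((fun U : GaugeField (F.P Ts) 0 ↥(Matrix.specialUnitaryGroup (Fin 2) ℂ) => ∏ i ∈ Finset.range (Ts - j), (if h : j + 1 + i ≤ Ts then (∏ p : Plaq (F.P (j + 1 + i)) 0, max 0 (min 1 ((24 / 25 * θBal F.L γ b₀ p₀ (j + 1 + i) - dist1 (GaugeField.plaqHol (descendTo F ℰp (j + 1 + i) Ts h U) p)) / ((24 / 25 - 1 / 2) * θBal F.L γ b₀ p₀ (j + 1 + i))))) else 1)) (Φ (V, z)) * ρ' Ts (Φ (V, z)) * (J (V, z) : ℝ)) := fun z => by ring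
      simp_rw [hnum]
      rw [← integral_div]
      refine integral_congr_ae (Eventually.of_forall fun z => ?_)
      simp only [wgt, wNum, mwCut, Real.rpow_eq_pow, Real.rpow_zero, sub_zero, Real.rpow_one, one_mul, mul_div_assoc]
    -- the witnesses: c′ := 0, a′ := 0, k′_LIN := k′ + kX + 2·kXᵀ + kL
    refine ⟨fun _ => 0, 0,
      (NT + 3 * NX + NL) * ((((F.L : ℝ) ^ j / γ) * θBal F.L γ b₀ p₀ j ^ 2) / (((F.L : ℝ) ^ Ts / γ) * θBal F.L γ b₀ p₀ Ts ^ 2)) * w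
        + (δT j + 3 * δX j + δL j) * (((F.L : ℝ) ^ j / γ) * θBal F.L γ b₀ p₀ j ^ 2),
      le_rfl, ?_, ?_, fun p => by simp, fun B B' => k' B B' + kX B B' + 2 * kX B' B + kL B B', ?_, ?_, ?_⟩
    · -- 0 ≤ w′
      have h1 : 0 ≤ NT + 3 * NX + NL := by positivity
      have h2 : 0 ≤ δT j + 3 * δX j + δL j := by
        obtain ⟨a1, a2, a3⟩ := hδ0 j
        exact add_nonneg (add_nonneg a1 (mul_nonneg (by norm_num) a2)) a3
      exact add_nonneg (mul_nonneg (mul_nonneg h1 (div_nonneg hDj.le hDT.le)) hw0) (mul_nonneg h2 hDj.le)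
    · -- the budget line
      have key : ((NT + 3 * NX + NL) * ((((F.L : ℝ) ^ j / γ) * θBal F.L γ b₀ p₀ j ^ 2) / (((F.L : ℝ) ^ Ts / γ) * θBal F.L γ b₀ p₀ Ts ^ 2)) * w
          + (δT j + 3 * δX j + δL j) * (((F.L : ℝ) ^ j / γ) * θBal F.L γ b₀ p₀ j ^ 2)) / (((F.L : ℝ) ^ j / γ) * θBal F.L γ b₀ p₀ j ^ 2)
          = (NT + 3 * NX + NL) * (w / (((F.L : ℝ) ^ Ts / γ) * θBal F.L γ b₀ p₀ Ts ^ 2)) + (δT j + 3 * δX j + δL j) := by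
        field_simp
      rw [key, zero_add, one_mul, add_zero]
      exact add_le_add (mul_le_mul_of_nonneg_right (le_max_right _ _) hx0) le_rfl
    · intro B B'
      exact add_nonneg (add_nonneg (add_nonneg (hk'0 B B') (hkX0 B B')) (mul_nonneg two_pos.le (hkX0 B' B))) (hkL0 B B')
    · -- row mass of k′_LIN
      intro B
      have hcol : ∑ B', kX B' B * Real.exp (κ * (B.src.tdist B'.src : ℝ)) ≤ NX * ((((F.L : ℝ) ^ j / γ) * θBal F.L γ b₀ p₀ j ^ 2) /
          (((F.L : ℝ) ^ Ts / γ) * θBal F.L γ b₀ p₀ Ts ^ 2)) * w + δX j * (((F.L : ℝ) ^ j / γ) * θBal F.L γ b₀ p₀ j ^ 2) := by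
        have h := hkXcol B
        refine le_of_eq_of_le (Finset.sum_congr rfl fun B' _ => ?_) h
        rw [tdist_comm']
      have hsplit : ∑ B', (k' B B' + kX B B' + 2 * kX B' B + kL B B') * Real.exp (κ * (B.src.tdist B'.src : ℝ))
          = (∑ B', k' B B' * Real.exp (κ * (B.src.tdist B'.src : ℝ))) + (∑ B', kX B B' * Real.exp (κ * (B.src.tdist B'.src : ℝ)))
            + 2 * (∑ B', kX B' B * Real.exp (κ * (B.src.tdist B'.src : ℝ))) + (∑ B', kL B B' * Real.exp (κ * (B.src.tdist B'.src : ℝ))) := by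
        rw [Finset.mul_sum, ← Finset.sum_add_distrib, ← Finset.sum_add_distrib, ← Finset.sum_add_distrib]
        exact Finset.sum_congr rfl fun B' _ => by ring
      rw [hsplit]
      calc _ ≤ _ := add_le_add (add_le_add (add_le_add (hk'row B) (hkXrow B)) (mul_le_mul_of_nonneg_left hcol two_pos.le)) (hkLrow B)
        _ = _ := by ring
    · -- the square clause
      intro b b' v v' U V W Y hv hv' hU hV hW hY hVU hVb hWU hWb' hYV hYb'
      simp only [zero_mul, Finset.sum_const_zero, mul_zero, sub_zero]
      have hθ4 : 0 < θBal F.L γ b₀ p₀ j / 4 := by positivity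
      have hvc : ‖v‖ ≤ rc * (θBal F.L γ b₀ p₀ j / 4) := hv.trans (mul_le_mul_of_nonneg_right (half_le_self hrc.le) hθ4.le)
      have hvc' : ‖v'‖ ≤ rc * (θBal F.L γ b₀ p₀ j / 4) := hv'.trans (mul_le_mul_of_nonneg_right (half_le_self hrc.le) hθ4.le)
      -- the fourth corner's law edge
      obtain ⟨m, hm, hYW, hYbm⟩ := fourthCorner_lawEdge U V W Y b b' v v' hVU hVb hWU hWb' hYV hYb'
      have hs3 : Real.sqrt 3 ≤ 2 := by
        rw [show (2 : ℝ) = Real.sqrt 4 by rw [show (4 : ℝ) = 2 ^ 2 by norm_num, Real.sqrt_sq (by norm_num : (0:ℝ) ≤ 2)]]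
        exact Real.sqrt_le_sqrt (by norm_num)
      have hm2 : ‖m‖ ≤ 2 * ‖v‖ := hm.trans (mul_le_mul_of_nonneg_right hs3 (norm_nonneg v))
      have hmc : ‖m‖ ≤ rc * (θBal F.L γ b₀ p₀ j / 4) := by
        refine hm2.trans ?_
        rw [show rc * (θBal F.L γ b₀ p₀ j / 4) = 2 * (rc / 2 * (θBal F.L γ b₀ p₀ j / 4)) by ring]
        exact mul_le_mul_of_nonneg_left hv two_pos.le
      -- abbreviations for the nine basic integrals
      rw [hrep U hU, hrep V hV, hrep W hW, hrep Y hY]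
      -- the four brackets
      obtain ⟨iUY, iVY, iWY, iYY, hIA⟩ := hA b b' v v' U V W Y Y hvc hvc' hU hV hW hY hY hVU hVb hWU hWb' hYV hYb'
      obtain ⟨iUV, iVV, iUY', iVY', hI1⟩ := hLX b b' v v' U V V Y hvc hvc' hU hV hV hY hVU hVb hYV hYb'
      obtain ⟨iUW, iWW, iUY'', iWY', hI2⟩ := hLX b' b v' m U W W Y hvc' hmc hU hW hW hY hWU hWb' hYW hYbm
      obtain ⟨iUU, iUV', iUW', iUY''', hI0⟩ := hL0 b b' v v' U V W Y hvc hvc' hU hV hW hY hVU hVb hWU hWb' hYV hYb'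
      -- bracket A as four basic integrals
      have hAeq : ∫ z, ((Real.log (ρ Ts (Φ (Y, z))) - Real.log (ρ' Ts (Φ (Y, z)))) - (Real.log (ρ Ts (Φ (V, z))) - Real.log (ρ' Ts (Φ (V, z))))
            - (Real.log (ρ Ts (Φ (W, z))) - Real.log (ρ' Ts (Φ (W, z)))) + (Real.log (ρ Ts (Φ (U, z))) - Real.log (ρ' Ts (Φ (U, z)))))
            * (wgt F γ b₀ p₀ j Ts ρ ρ' τ Φ J 0) Y z ∂τ
          = (∫ z, (Real.log (ρ Ts (Φ (Y, z))) - Real.log (ρ' Ts (Φ (Y, z)))) * (wgt F γ b₀ p₀ j Ts ρ ρ' τ Φ J 0) Y z ∂τ)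
            - (∫ z, (Real.log (ρ Ts (Φ (V, z))) - Real.log (ρ' Ts (Φ (V, z)))) * (wgt F γ b₀ p₀ j Ts ρ ρ' τ Φ J 0) Y z ∂τ)
            - (∫ z, (Real.log (ρ Ts (Φ (W, z))) - Real.log (ρ' Ts (Φ (W, z)))) * (wgt F γ b₀ p₀ j Ts ρ ρ' τ Φ J 0) Y z ∂τ)
            + (∫ z, (Real.log (ρ Ts (Φ (U, z))) - Real.log (ρ' Ts (Φ (U, z)))) * (wgt F γ b₀ p₀ j Ts ρ ρ' τ Φ J 0) Y z ∂τ) :=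
        integral_comb4_mul τ (fun z => (Real.log (ρ Ts (Φ (Y, z))) - Real.log (ρ' Ts (Φ (Y, z))))) (fun z => (Real.log (ρ Ts (Φ (V, z))) - Real.log (ρ' Ts (Φ (V, z))))) (fun z => (Real.log (ρ Ts (Φ (W, z))) - Real.log (ρ' Ts (Φ (W, z))))) (fun z => (Real.log (ρ Ts (Φ (U, z))) - Real.log (ρ' Ts (Φ (U, z)))))
          (fun z => (wgt F γ b₀ p₀ j Ts ρ ρ' τ Φ J 0) Y z) iYY iVY iWY iUY
      rw [hAeq] at hIA
      rw [rebracket (∫ z, (Real.log (ρ Ts (Φ (Y, z))) - Real.log (ρ' Ts (Φ (Y, z)))) * (wgt F γ b₀ p₀ j Ts ρ ρ' τ Φ J 0) Y z ∂τ) (∫ z, (Real.log (ρ Ts (Φ (V, z))) - Real.log (ρ' Ts (Φ (V, z)))) * (wgt F γ b₀ p₀ j Ts ρ ρ' τ Φ J 0) V z ∂τ) (∫ z, (Real.log (ρ Ts (Φ (W, z))) - Real.log (ρ' Ts (Φ (W, z)))) * (wgt F γ b₀ p₀ j Ts ρ ρ' τ Φ J 0) W z ∂τ) (∫ z, (Real.log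 (ρ Ts (Φ (U, z))) - Real.log (ρ' Ts (Φ (U, z)))) * (wgt F γ b₀ p₀ j Ts ρ ρ' τ Φ J 0) U z ∂τ) (∫ z, (Real.log (ρ Ts (Φ (V, z))) - Real.log (ρ' Ts (Φ (V, z)))) * (wgt F γ b₀ p₀ j Ts ρ ρ' τ Φ J 0) Y z ∂τ) (∫ z, (Real.log (ρ Ts (Φ (W, z))) - Real.log (ρ' Ts (Φ (W, z)))) * (wgt F γ b₀ p₀ j Ts ρ ρ' τ Φ J 0) Y z ∂τ) (∫ z, (Real.log (ρ Ts (Φ (U, z))) - Real.log (ρ' Ts (Φ (U, z)))) * (wgt F γ b₀ p₀ j Ts ρ ρ' τ Φ J 0) Y z ∂τ) (∫ z, (Real.log (ρ Ts (Φ (U, z))) - Real.log (ρ' Ts (Φ (U, z)))) * (wgt F γ b₀ p₀ j Ts ρ ρ' τ Φ J 0) V z ∂τ) (∫ z, (Real.log (ρ Ts (Φ (U, z))) - Real.log (ρ' Ts (Φ (U, z)))) * (wgt F γ b₀ p₀ j Ts ρ ρ' τ Φ J 0) W z ∂τ)]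
      have hs : 0 ≤ ‖v‖ / (θBal F.L γ b₀ p₀ j / 4) := div_nonneg (norm_nonneg _) hθ4.le
      have hs' : 0 ≤ ‖v'‖ / (θBal F.L γ b₀ p₀ j / 4) := div_nonneg (norm_nonneg _) hθ4.le
      have hI2' : |((∫ z, (Real.log (ρ Ts (Φ (W, z))) - Real.log (ρ' Ts (Φ (W, z)))) * (wgt F γ b₀ p₀ j Ts ρ ρ' τ Φ J 0) Y z ∂τ)
            - (∫ z, (Real.log (ρ Ts (Φ (U, z))) - Real.log (ρ' Ts (Φ (U, z)))) * (wgt F γ b₀ p₀ j Ts ρ ρ' τ Φ J 0) Y z ∂τ))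
            - ((∫ z, (Real.log (ρ Ts (Φ (W, z))) - Real.log (ρ' Ts (Φ (W, z)))) * (wgt F γ b₀ p₀ j Ts ρ ρ' τ Φ J 0) W z ∂τ)
            - (∫ z, (Real.log (ρ Ts (Φ (U, z))) - Real.log (ρ' Ts (Φ (U, z)))) * (wgt F γ b₀ p₀ j Ts ρ ρ' τ Φ J 0) W z ∂τ))|
          ≤ 2 * kX b' b * (‖v‖ / (θBal F.L γ b₀ p₀ j / 4)) * (‖v'‖ / (θBal F.L γ b₀ p₀ j / 4)) := by
        refine hI2.trans ?_
        have hmv : ‖m‖ / (θBal F.L γ b₀ p₀ j / 4) ≤ 2 * (‖v‖ / (θBal F.L γ b₀ p₀ j / 4)) := by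
          rw [← mul_div_assoc]; exact div_le_div_of_nonneg_right hm2 hθ4.le
        have hk := hkX0 b' b
        calc kX b' b * (‖v'‖ / (θBal F.L γ b₀ p₀ j / 4)) * (‖m‖ / (θBal F.L γ b₀ p₀ j / 4))
            ≤ kX b' b * (‖v'‖ / (θBal F.L γ b₀ p₀ j / 4)) * (2 * (‖v‖ / (θBal F.L γ b₀ p₀ j / 4))) :=
              mul_le_mul_of_nonneg_left hmv (mul_nonneg hk hs')
          _ = 2 * kX b' b * (‖v‖ / (θBal F.L γ b₀ p₀ j / 4)) * (‖v'‖ / (θBal F.L γ b₀ p₀ j / 4)) := by ring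
      refine (abs_add_four _ _ _ _).trans ?_
      refine (add_le_add (add_le_add (add_le_add hIA hI1) hI2') hI0).trans (le_of_eq ?_)
      ring


end Summit.QuantumFields.YangMills.Cruxes.FluctuationComparisonRegPrIntL.LinKnit

end
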